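import Literature.Analysis.FluidPDE.Seregin2023.MorreyTypeIBound
import Literature.Analysis.FluidPDE.Seregin2023.TypeIIScenarioExcluded
import Literature.Analysis.FluidPDE.BesovScaledEnergyBounds
import Literature.Analysis.FluidPDE.ESSLocalHolderConcentration
import HarnessLib

/-!
# Seregin 2023, Theorem 1.1 (bounded generalised Morrey quantity ⇒ bounded scaled energies):
# the named fact DISCHARGED

Proof-only file (no definition, no named fact, no `sorry`): the discharge
`seregin2023_morreyBound_scaledEnergies_holds` of the named fact
`Seregin2023.seregin2023_morreyBound_scaledEnergies` (`MorreyTypeIBound.lean`; G. Seregin, *A note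
on potential Type II blowups of suitable weak solutions to the Navier–Stokes equations*, CPAA
(2023) = arXiv:2304.04045 [`Seregin2023`], Thm 1.1 p. 3, proof outlined in Appendix III
pp. 25–26, after Seregin–Šverák [8] and Seregin–Zajaczkowski [9]).

## The printed proof and the proof here

Appendix III (pp. 25–26) proves Thm 1.1 by a *cubic estimate* — in each of its cases
(`l = 3`; `1 ≤ l < 3`; `l > 3, s ≥ 3`; `l > 3, 3/2 < s < 3`) Hölder's inequality, and in the last
case the Gagliardo–Nirenberg inequality, give `C(R) ≤ c M^{τ} (E(R) + A(R))^{β}` with `β < 1`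
("`C(R) ≤ cM^{1/q} A^μ(R)`, `0 < μ < 1`", "`C(R) ≤ cM^{1/q}(E(R)+A(R))^{3γ}`, `3γ < 1`") — and
then "it remains to repeat arguments of [8]": the local energy inequality
`A(R/2) + E(R/2) ≤ c (C^{2/3} + C + D^{2/3}C^{1/3})(R)`, the pressure decay estimate
`D(θR) ≤ c (θ D(R) + θ⁻² C(R))` and Young's inequality make `C + D` contract along the scales
`θᵏ`, whence all of `A, E, C, D` stay bounded as `r → 0`.

This file follows that architecture with one simplification of the case analysis: a single
two-parameter Hölder interpolation covers the whole range `l > κ` (`⟺ 3/s + 2/l < 2`) at once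
(`exists_exponents`): with `a = 1 + η`, `η = η(s,l) > 0` small,
`∫_B |v|³ ≤ (∫_B |v|^s)^{a/s} (∫_B |v|^{p̃})^{(3-a)/p̃}`, `p̃ = (3-a)s/(s-a)`, then Hölder in time
with exponents `l/a`, `l/(l-a)`, and the energy class bounds the second factor
(`L^{θ̃}_t L^{p̃}_x`, `θ̃ = (3-a)l/(l-a)`, is subcritical with respect to `L^∞_t L²_x ∩ L²_t H¹_x`
exactly when `η` is small — this is where `3/s + 2/l < 2` enters), giving
`C(R) ≤ K₀ (M^{s,l}_κ(R))^{a/l} (1 + A(R) + E(R))^{(3-a)/2}` (`cubic_estimate`; the additive `1`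
is a harmless normalisation, all quantities being scale invariant). The energy-class embedding is
the tree's unit-cylinder estimate `exists_mixedNorm_smallBall_le` (`TypeIIScenarioExcluded.lean`),
transported to radius `R` by the Navier–Stokes scaling (`cknC_zoom`, `zoom_floor_eq`,
`zoom_slice_energy_le`, `zoom_grad_le`). The iteration is the tree's Wang–Zhang scheme
(`exists_bound_of_cubic_step_of_pressure_decay`, `BesovScaledEnergyBounds.lean`) re-proved here
for an arbitrary additive constant (`exists_bound_of_cubic_step_at_of_pressure_decay`: the printed
scheme needs the cubic step at ONE ratio `δ₀(c_p)` only, which is what a sublinear power `β < 1`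
provides through Young's inequality), fed with `Seregin2020.localEnergyBound_top` and
`seregin_sverak_pressure_decay_holds`; the passage from bounded `C` to bounded `A + E + C + D` is
`Seregin2020.scaledEnergies_bounded_of_cknC_le_unif` (Seregin 2006, Lemma 2.1 (b)).

The typed statement (see `MorreyTypeIBound.lean`, "Rendering") asserts (1.6) with constants
`ε₀, c, α₀` that may depend on the solution and with `c₀(ε, M) → 0` as `M → 0⁺`; in that reading
(1.6) follows from — and is essentially equivalent to — the boundedness of `𝓔 = E + A + D` on
`]0, 1]` under `M < ∞` and `𝓔(1) < ∞` (`exists_energySumEss_le`), which is the theorem's content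
("a sufficient condition for the point `z = 0` to be a Type I blowup", p. 3) and exactly what the
consumers in `MorreyTypeIBound.lean` (`….energySumEss_lt_top`, `….blowupIndex_lt_top`,
`….not_isTypeIIAt`) extract from it. The uniform dependence of `ε₀, c, α₀` on `(s, l)` only
(Prop. 7.1 / Appendix II) is not claimed by the fact and not proved here.

## Contents (namespace `Literature.Analysis.FluidPDE.Seregin2023`)

* `exists_bound_of_cubic_step_at_of_pressure_decay` — the abstract iteration;
* `exists_exponents` — the interpolation exponents for `3/s + 2/l < 2`;
* `lintegral_cube_le_holder` — the two Hölder inequalities on `]-1,0[ × B(0,1)`;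
* `exists_mixedNorm_le_of_energy` — the energy-class bound of `‖w‖_{L^{θ̃}_t L^{p̃}_x(Q(1))}`,
  homogeneous form;
* `exists_cubic_estimate_one`, `exists_cubic_estimate` — the cubic estimate at radius `1` and at
  every radius `0 < R ≤ 1`;
* `exists_energySumEss_le` — `M < ∞`, `𝓔(1) < ∞ ⇒ sup_{0<r≤1} 𝓔(r) < ∞`;
* `seregin2023_morreyBound_scaledEnergies_holds` — the discharge;
* `morreyBounded_energySumEss_lt_top`, `morreyBounded_blowupIndex_lt_top`,
  `morreyBounded_not_isTypeIIAt` — the consumers of `MorreyTypeIBound.lean`, now unconditional;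
* `energySumEss_one_lt_top` — `𝓔(1) < ∞` is automatic for the class (`background_finite`), whence
  `energySumEss_lt_top_of_morreySup_lt_top`, `blowupIndex_lt_top_of_morreySup_lt_top`,
  `not_isTypeIIAt_of_morreySup_lt_top`, `isTypeIAt_of_morreySup_lt_top` (bounded `M^{s,l}_κ` at a
  singular point ⇒ Type I in the sense of Seregin 2020, Def. 1.7);
* `exists_energySumEss_le_unif` — the bound with `K = K(s, l, M_b, E_b)` fixed before the solution.

## References

* G. Seregin, CPAA (2023) = arXiv:2304.04045, Thm 1.1 (p. 3), Appendix III (pp. 25–26).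
  [`Seregin2023`]
* G. Seregin, V. Šverák, *Regularity criteria for Navier–Stokes solutions*, Handbook of
  mathematical analysis in mechanics of viscous fluids, Springer (2018), 829–867 (ref. [8]).
* G. Seregin, W. Zajaczkowski, Zap. Nauchn. Sem. POMI 336 (2006), 46–54 (ref. [9]).
* W. Wang, Z. Zhang, Sci. China Math. 60 (2017), Lemma 4.1 (the iteration). [`WangZhang2016`]
* G. Seregin, Zap. Nauchn. Sem. POMI 336 (2006) = arXiv:math/0607537, Lemma 2.1 (b). [`Seregin2006`]
-/

noncomputable section

open _root_.MeasureTheory _root_.Set _root_.Filter _root_.Metric _root_.Function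
  _root_.TopologicalSpace
open scoped _root_.ENNReal _root_.NNReal _root_.Topology

namespace Literature.Analysis.FluidPDE.Seregin2023

/-! ## §1. The abstract iteration with an arbitrary additive constant -/

/-- **The iteration of [8] / Wang–Zhang 2017, Lemma 4.1, with a general additive constant.** For
every pressure-decay constant `c_p` there is a ratio `δ₀ = δ₀(c_p) > 0` and constants `A₁, A₂` such
that: if `C, D : ℝ → [0, ∞]` satisfy the scaling monotonicity `C(r) ≤ (R/r)² C(R)`,
`D(r) ≤ (R/r)² D(R)` (`0 < r ≤ R ≤ R₀`), the pressure decay estimate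
`D(ϱ) ≤ c_p ((ϱ/ρ) D(ρ) + (ρ/ϱ)² C(ρ))` and the cubic step `C(r) ≤ δ₀ (C(6r) + D(6r)) + Φ`
(`6r ≤ R₀`) at the single ratio `δ₀`, then `C(ρ) + D(ρ) ≤ A₁ (C(R₀) + D(R₀)) + A₂ Φ` for all
`0 < ρ ≤ R₀`. The proof is the one of `exists_bound_of_cubic_step_of_pressure_decay`
(`θ = (2(1 + 37 c_p))⁻¹`, `δ₀ = θ³`, one contraction step `F(θR/6) ≤ F(R)/2 + c''`, iteration
along `(θ/6)ᵏ R₀`). [cite: WangZhang2016, Lemma 4.1 ("a standard iterative scheme")] -/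
theorem exists_bound_of_cubic_step_at_of_pressure_decay (cp : ℝ≥0) :
    ∃ δ₀ : ℝ≥0, 0 < δ₀ ∧ ∃ A₁ A₂ : ℝ≥0, ∀ (C D : ℝ → ℝ≥0∞) (R₀ : ℝ) (Φ : ℝ≥0∞), 0 < R₀ →
      (∀ r R : ℝ, 0 < r → r ≤ R → R ≤ R₀ → C r ≤ ENNReal.ofReal (R / r) ^ 2 * C R) →
      (∀ r R : ℝ, 0 < r → r ≤ R → R ≤ R₀ → D r ≤ ENNReal.ofReal (R / r) ^ 2 * D R) →
      (∀ r : ℝ, 0 < r → 6 * r ≤ R₀ → C r ≤ δ₀ * (C (6 * r) + D (6 * r)) + Φ) →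
      (∀ ϱ ρ : ℝ, 0 < ϱ → ϱ ≤ ρ → ρ ≤ R₀ →
        D ϱ ≤ cp * (ENNReal.ofReal (ϱ / ρ) * D ρ + ENNReal.ofReal ((ρ / ϱ) ^ 2) * C ρ)) →
      ∀ ρ ∈ Ioc 0 R₀, C ρ + D ρ ≤ A₁ * (C R₀ + D R₀) + A₂ * Φ := by
  -- ### the ratio `θ` and the constants
  set θ : ℝ := (2 * (1 + 37 * (cp : ℝ)))⁻¹ with hθdef
  have hθpos : 0 < θ := by rw [hθdef]; positivity
  have hθhalf : θ ≤ 1 / 2 := by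
    rw [hθdef, inv_le_comm₀ (by positivity) (by norm_num)]
    have : (0 : ℝ) ≤ 37 * (cp : ℝ) := by positivity
    linarith
  have hθ1 : θ ≤ 1 := hθhalf.trans (by norm_num)
  have hθkey : θ * (1 + 37 * (cp : ℝ)) = 1 / 2 := by
    rw [hθdef]; field_simp
  set δ : ℝ≥0 := ⟨θ ^ 3, by positivity⟩ with hδdef
  have hδpos : 0 < δ := by
    rw [hδdef, ← NNReal.coe_pos]
    show (0 : ℝ) < θ ^ 3
    positivity
  set κ : ℝ := θ / 6 with hκdef
  have hκpos : 0 < κ := by rw [hκdef]; positivity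
  have hκ1 : κ < 1 := by rw [hκdef]; linarith
  -- the multiplier of `Φ` in one contraction step, and in the conclusion
  set m : ℝ≥0∞ := 1 + cp * ENNReal.ofReal (θ⁻¹ ^ 2) with hm
  have hmtop : m ≠ ⊤ := ENNReal.add_ne_top.2 ⟨ENNReal.one_ne_top,
    ENNReal.mul_ne_top ENNReal.coe_ne_top ENNReal.ofReal_ne_top⟩
  refine ⟨δ, hδpos, (ENNReal.ofReal (κ⁻¹ ^ 2)).toNNReal,
    (ENNReal.ofReal (κ⁻¹ ^ 2) * (2 * m)).toNNReal, ?_⟩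
  intro C D R₀ Φ hR₀ hmonoC hmonoD hstep hPD ρ hρ
  rw [ENNReal.coe_toNNReal ENNReal.ofReal_ne_top,
    ENNReal.coe_toNNReal (ENNReal.mul_ne_top ENNReal.ofReal_ne_top (ENNReal.mul_ne_top (by simp) hmtop))]
  set c'' : ℝ≥0∞ := Φ * m with hc''
  set F : ℝ → ℝ≥0∞ := fun r => C r + D r with hFdef
  -- ### one contraction step: `F(θR/6) ≤ F(R)/2 + c''` for `0 < R ≤ R₀`
  have hcontract : ∀ R : ℝ, 0 < R → R ≤ R₀ → F (κ * R) ≤ 2⁻¹ * F R + c'' := by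
    intro R hR hRR₀
    have hr : 0 < κ * R := mul_pos hκpos hR
    have h6r : 6 * (κ * R) = θ * R := by rw [hκdef]; ring
    have hθR : 0 < θ * R := mul_pos hθpos hR
    have hθRle : θ * R ≤ R := mul_le_of_le_one_left hR.le hθ1
    -- monotonicity factors
    have hmC : C (θ * R) ≤ ENNReal.ofReal (θ⁻¹ ^ 2) * C R := by
      have h := hmonoC (θ * R) R hθR hθRle hRR₀
      rwa [← ENNReal.ofReal_pow (by positivity), show R / (θ * R) = θ⁻¹ by field_simp] at h
    have hmD : D (θ * R) ≤ ENNReal.ofReal (θ⁻¹ ^ 2) * D R := by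
      have h := hmonoD (θ * R) R hθR hθRle hRR₀
      rwa [← ENNReal.ofReal_pow (by positivity), show R / (θ * R) = θ⁻¹ by field_simp] at h
    have hδθ : (δ : ℝ≥0∞) * ENNReal.ofReal (θ⁻¹ ^ 2) = ENNReal.ofReal θ := by
      have e : (δ : ℝ≥0∞) = ENNReal.ofReal (θ ^ 3) := by
        rw [← ENNReal.ofReal_coe_nnreal]
        rfl
      rw [e, ← ENNReal.ofReal_mul (by positivity)]
      congr 1
      field_simp
    have hcp : (cp : ℝ≥0∞) = ENNReal.ofReal (cp : ℝ) := (ENNReal.ofReal_coe_nnreal).symm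
    -- the cubic step at `r = κR` (`6r = θR`)
    have hC1 : C (κ * R) ≤ ENNReal.ofReal θ * F R + Φ := by
      have h := hstep (κ * R) hr (by rw [h6r]; exact hθRle.trans hRR₀)
      rw [h6r] at h
      refine h.trans ?_
      gcongr ?_ + _
      calc (δ : ℝ≥0∞) * (C (θ * R) + D (θ * R))
          ≤ δ * (ENNReal.ofReal (θ⁻¹ ^ 2) * C R + ENNReal.ofReal (θ⁻¹ ^ 2) * D R) := by gcongr
        _ = ((δ : ℝ≥0∞) * ENNReal.ofReal (θ⁻¹ ^ 2)) * F R := by rw [hFdef]; ring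
        _ = ENNReal.ofReal θ * F R := by rw [hδθ]
    -- the cubic step at `r = R/6`
    have hC6 : C (R / 6) ≤ (δ : ℝ≥0∞) * F R + Φ := by
      have h := hstep (R / 6) (by positivity) (by linarith)
      rw [show 6 * (R / 6) = R by ring] at h
      exact h
    -- the pressure decay from `R/6` to `κR = θ (R/6)`
    have hD1 : D (κ * R) ≤ cp * (ENNReal.ofReal θ * (36 * D R) +
        ENNReal.ofReal (θ⁻¹ ^ 2) * ((δ : ℝ≥0∞) * F R + Φ)) := by
      have h := hPD (κ * R) (R / 6) hr (by rw [hκdef]; nlinarith) (by linarith)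
      have e1 : κ * R / (R / 6) = θ := by rw [hκdef]; field_simp
      have e2 : (R / 6 / (κ * R)) ^ 2 = θ⁻¹ ^ 2 := by rw [hκdef]; field_simp
      rw [e1, e2] at h
      refine h.trans ?_
      have hD6 : D (R / 6) ≤ 36 * D R := by
        have h' := hmonoD (R / 6) R (by positivity) (by linarith) hRR₀
        rwa [show R / (R / 6) = 6 by field_simp, ENNReal.ofReal_ofNat,
          show ((6 : ℝ≥0∞)) ^ 2 = 36 by norm_num] at h'
      gcongr
    -- summing up
    have hDF : D R ≤ F R := le_add_self
    calc F (κ * R) = C (κ * R) + D (κ * R) := rfl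
      _ ≤ (ENNReal.ofReal θ * F R + Φ) + cp * (ENNReal.ofReal θ * (36 * D R) +
          ENNReal.ofReal (θ⁻¹ ^ 2) * ((δ : ℝ≥0∞) * F R + Φ)) := add_le_add hC1 hD1
      _ ≤ (ENNReal.ofReal θ * F R + Φ) + cp * (ENNReal.ofReal θ * (36 * F R) +
          ENNReal.ofReal (θ⁻¹ ^ 2) * ((δ : ℝ≥0∞) * F R + Φ)) := by gcongr
      _ = (ENNReal.ofReal θ * (1 + 37 * cp)) * F R + Φ * (1 + cp * ENNReal.ofReal (θ⁻¹ ^ 2)) := by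
          have e : (cp : ℝ≥0∞) * (ENNReal.ofReal (θ⁻¹ ^ 2) * ((δ : ℝ≥0∞) * F R)) =
              cp * (((δ : ℝ≥0∞) * ENNReal.ofReal (θ⁻¹ ^ 2)) * F R) := by ring
          rw [mul_add (cp : ℝ≥0∞), mul_add (ENNReal.ofReal (θ⁻¹ ^ 2)), mul_add (cp : ℝ≥0∞), e, hδθ]
          ring
      _ = 2⁻¹ * F R + c'' := by
          rw [hc'', hm, hcp, ← ENNReal.ofReal_ofNat 37, ← ENNReal.ofReal_one,
            ← ENNReal.ofReal_mul (by norm_num), ← ENNReal.ofReal_add (by norm_num) (by positivity),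
            ← ENNReal.ofReal_mul hθpos.le, hθkey, ENNReal.ofReal_one, one_div,
            ENNReal.ofReal_inv_of_pos two_pos, ENNReal.ofReal_ofNat]
  -- ### the iteration along `κ^k R₀`
  have hiter : ∀ k : ℕ, F (κ ^ k * R₀) ≤ F R₀ + 2 * c'' := by
    intro k
    induction k with
    | zero => rw [pow_zero, one_mul]; exact le_self_add
    | succ k ih =>
        have hRk : 0 < κ ^ k * R₀ := by positivity
        have hRk1 : κ ^ k * R₀ ≤ R₀ := mul_le_of_le_one_left hR₀.le (pow_le_one₀ hκpos.le hκ1.le)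
        calc F (κ ^ (k + 1) * R₀) = F (κ * (κ ^ k * R₀)) := by rw [pow_succ]; ring_nf
          _ ≤ 2⁻¹ * F (κ ^ k * R₀) + c'' := hcontract _ hRk hRk1
          _ ≤ 2⁻¹ * (F R₀ + 2 * c'') + c'' := by gcongr
          _ = 2⁻¹ * F R₀ + 2 * c'' := by
              rw [mul_add, ← mul_assoc, ENNReal.inv_mul_cancel two_ne_zero ENNReal.ofNat_ne_top, one_mul,
                add_assoc, ← two_mul]
          _ ≤ F R₀ + 2 * c'' := by
              gcongr
              calc 2⁻¹ * F R₀ ≤ 1 * F R₀ := mul_le_mul' (ENNReal.inv_le_one.2 one_le_two) le_rfl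
                _ = F R₀ := one_mul _
  -- ### positioning of `ρ`
  have hρpos : 0 < ρ := hρ.1
  obtain ⟨k, hk1, hk2⟩ := exists_pow_mul_near hκpos hκ1 hR₀ hρpos hρ.2
  have hRk : 0 < κ ^ k * R₀ := by positivity
  have hRk1 : κ ^ k * R₀ ≤ R₀ := mul_le_of_le_one_left hR₀.le (pow_le_one₀ hκpos.le hκ1.le)
  have hratio : κ ^ k * R₀ / ρ ≤ κ⁻¹ := by
    rw [div_le_iff₀ hρ.1]
    have h : κ * (κ ^ k * R₀) < ρ := by rw [pow_succ] at hk1; linarith [hk1]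
    have h' : κ ^ k * R₀ < κ⁻¹ * ρ := by
      rw [← div_eq_inv_mul, lt_div_iff₀ hκpos]; linarith
    exact h'.le
  have hmF : F ρ ≤ ENNReal.ofReal (κ⁻¹ ^ 2) * F (κ ^ k * R₀) := by
    have h1 := hmonoC ρ (κ ^ k * R₀) hρ.1 hk2 hRk1
    have h2 := hmonoD ρ (κ ^ k * R₀) hρ.1 hk2 hRk1
    have hfac : ENNReal.ofReal (κ ^ k * R₀ / ρ) ^ 2 ≤ ENNReal.ofReal (κ⁻¹ ^ 2) := by
      rw [← ENNReal.ofReal_pow (by positivity)]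
      exact ENNReal.ofReal_le_ofReal (pow_le_pow_left₀ (by positivity) hratio 2)
    calc F ρ = C ρ + D ρ := rfl
      _ ≤ ENNReal.ofReal (κ ^ k * R₀ / ρ) ^ 2 * C (κ ^ k * R₀) +
          ENNReal.ofReal (κ ^ k * R₀ / ρ) ^ 2 * D (κ ^ k * R₀) := add_le_add h1 h2
      _ = ENNReal.ofReal (κ ^ k * R₀ / ρ) ^ 2 * F (κ ^ k * R₀) := by rw [hFdef]; ring
      _ ≤ ENNReal.ofReal (κ⁻¹ ^ 2) * F (κ ^ k * R₀) := mul_le_mul' hfac le_rfl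
  calc C ρ + D ρ = F ρ := rfl
    _ ≤ ENNReal.ofReal (κ⁻¹ ^ 2) * F (κ ^ k * R₀) := hmF
    _ ≤ ENNReal.ofReal (κ⁻¹ ^ 2) * (F R₀ + 2 * c'') := mul_le_mul' le_rfl (hiter k)
    _ = ENNReal.ofReal (κ⁻¹ ^ 2) * (C R₀ + D R₀) + ENNReal.ofReal (κ⁻¹ ^ 2) * (2 * m) * Φ := by
        rw [hFdef, hc'']; ring

/-! ## §2. The interpolation exponents -/

/-- **The exponents of the cubic estimate.** If `1 ≤ s`, `1 ≤ l` and `κ(s,l) < l`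
(`⟺ 3/s + 2/l < 2`), there are `a ∈ ]1, 3[` with `a < s`, `a < l`, the Hölder exponents
`p̃ = (3-a)s/(s-a)` (space) and `θ̃ = (3-a)l/(l-a)` (time) — `a/s + (3-a)/p̃ = 1`,
`a/l + (3-a)/θ̃ = 1` — and `p' ∈ [2, 6]`, `p' > p̃`, with `θ̃ (3/2 - 3/p') < 2`, i.e. the mixed
norm `L^{θ̃}_t L^{p̃}_x` is subcritical with respect to the energy class (Appendix III, the
choice of `λ, μ, γ, q` in each case; here `a = 1 + η` with one explicit small `η(s,l) > 0`).
[cite: Seregin2023, Appendix III (pp. 25–26)] -/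
theorem exists_exponents {s l : ℝ} (hs : 1 ≤ s) (hl : 1 ≤ l) (hκ : kappa s l < l) :
    ∃ a pt θt p' : ℝ, 1 < a ∧ a < 3 ∧ a < s ∧ a < l ∧ 0 < pt ∧ pt < p' ∧ 2 ≤ p' ∧ p' ≤ 6 ∧
      0 < θt ∧ θt * (3 / 2 - 3 / p') < 2 ∧ a / s + (3 - a) / pt = 1 ∧ a / l + (3 - a) / θt = 1 := by
  have hs0 : 0 < s := by linarith
  have hl0 : 0 < l := by linarith
  -- `κ < l ⟺ 3/s + 2/l < 2`, whence `s > 3/2`, `l > 1`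
  have hσ : 3 / s + 2 / l < 2 := by
    have h := hκ
    unfold kappa at h
    have : l * (3 / s + 2 / l - 1) < l * 1 := by linarith
    have h2 := lt_of_mul_lt_mul_left this hl0.le
    linarith
  have hs32 : 3 / 2 < s := by
    have h1 : 3 / s < 2 := by
      have : 0 < 2 / l := by positivity
      linarith
    rw [div_lt_iff₀ hs0] at h1
    linarith
  have hl1 : 1 < l := by
    have h1 : 2 / l < 2 := by
      have : 0 < 3 / s := by positivity
      linarith
    rw [div_lt_iff₀ hl0] at h1
    linarith
  -- the slack `Δ = l (2 - 3/s - 2/l) = 2l - 2 - 3l/s > 0` and the coefficient bound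
  set Δ : ℝ := 2 * l - 2 - 3 * l / s with hΔ
  have hΔpos : 0 < Δ := by
    have h1 : 3 * l / s = l * (3 / s) := by ring
    have h2 : l * (3 / s + 2 / l) < l * 2 := mul_lt_mul_of_pos_left hσ hl0
    have h3 : l * (2 / l) = 2 := by field_simp
    rw [hΔ, h1]; nlinarith
  set cplus : ℝ := 2 + 3 * l / s + 3 * l / 2 with hcplus
  have hcplus0 : 0 < cplus := by rw [hcplus]; positivity
  -- the small parameter
  set η : ℝ := min (min (min ((s - 1) / 2) ((l - 1) / 2)) (min (1 / 2) ((2 * s - 3) / 6)))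
    (Δ / (2 * cplus)) with hηdef
  have hηpos : 0 < η := by
    rw [hηdef]
    refine lt_min (lt_min (lt_min (by linarith) (by linarith)) (lt_min (by norm_num) (by linarith)))
      (by positivity)
  have hη1 : η ≤ (s - 1) / 2 :=
    (min_le_left _ _).trans ((min_le_left _ _).trans (min_le_left _ _))
  have hη2 : η ≤ (l - 1) / 2 :=
    (min_le_left _ _).trans ((min_le_left _ _).trans (min_le_right _ _))
  have hη3 : η ≤ 1 / 2 :=
    (min_le_left _ _).trans ((min_le_right _ _).trans (min_le_left _ _))
  have hη4 : η ≤ (2 * s - 3) / 6 :=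
    (min_le_left _ _).trans ((min_le_right _ _).trans (min_le_right _ _))
  have hη5 : η ≤ Δ / (2 * cplus) := min_le_right _ _
  set a : ℝ := 1 + η with ha
  have has : a < s := by rw [ha]; linarith
  have hal : a < l := by rw [ha]; linarith
  have ha3 : a < 3 := by rw [ha]; linarith
  have ha1 : 1 < a := by rw [ha]; linarith
  have hsa : 0 < s - a := by linarith
  have hla : 0 < l - a := by linarith
  have h3a : 0 < 3 - a := by linarith
  set pt : ℝ := (3 - a) * s / (s - a) with hpt
  set θt : ℝ := (3 - a) * l / (l - a) with hθt
  have hpt0 : 0 < pt := by rw [hpt]; positivity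
  have hθt0 : 0 < θt := by rw [hθt]; positivity
  have hconj1 : a / s + (3 - a) / pt = 1 := by
    rw [hpt]; field_simp; ring
  have hconj2 : a / l + (3 - a) / θt = 1 := by
    rw [hθt]; field_simp; ring
  -- (i) `p̃ < 6`
  have hpt6 : pt < 6 := by
    rw [hpt, div_lt_iff₀ hsa]
    -- `(2-η) s < 6 (s - 1 - η) ⟺ η (6 - s) < 4 s - 6`
    have h46 : 0 < 4 * s - 6 := by linarith
    have key : η * (6 - s) < 4 * s - 6 := by
      rcases le_or_gt s 6 with h6 | h6
      · have : η * (6 - s) ≤ η * 6 := mul_le_mul_of_nonneg_left (by linarith) hηpos.le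
        nlinarith
      · have : η * (6 - s) < 0 := mul_neg_of_pos_of_neg hηpos (by linarith)
        linarith
    rw [ha]; nlinarith
  -- (ii) the gap `θ̃ (3/2 - 3/p̃) < 2`
  have hgap : θt * (3 / 2 - 3 / pt) < 2 := by
    have hsane : s - a ≠ 0 := hsa.ne'
    have hlane : l - a ≠ 0 := hla.ne'
    have h3ane : 3 - a ≠ 0 := h3a.ne'
    have hsne : s ≠ 0 := hs0.ne'
    have e : θt * (3 / 2 - 3 / pt) = 3 * l * (a / s - (a - 1) / 2) / (l - a) := by
      rw [hθt, hpt]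
      field_simp
      ring
    rw [e, div_lt_iff₀ hla]
    -- `3l(a/s - (a-1)/2) < 2(l-a) ⟺ η (2 + 3l/s - 3l/2) < Δ`
    have hcoef : η * (2 + 3 * l / s - 3 * l / 2) ≤ η * cplus := by
      refine mul_le_mul_of_nonneg_left ?_ hηpos.le
      rw [hcplus]
      have : 0 ≤ 3 * l / 2 := by positivity
      linarith
    have hηc : η * cplus ≤ Δ / 2 := by
      have h := hη5
      rw [le_div_iff₀ (by positivity)] at h
      linarith
    have h3 : 3 * l * (a / s - (a - 1) / 2) = 3 * l / s + η * (3 * l / s - 3 * l / 2) := by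
      rw [ha]; ring
    have h4 : 2 * (l - a) = Δ + 3 * l / s - 2 * η := by rw [ha, hΔ]; ring
    rw [h3, h4]
    have h5 : η * (3 * l / s - 3 * l / 2) + 2 * η = η * (2 + 3 * l / s - 3 * l / 2) := by ring
    linarith
  -- the exponent `p'`: `3/p'` strictly between `L = max(3/2 - 2/θ̃, 1/2)` and `U = min(3/p̃, 3/2)`
  set L : ℝ := max (3 / 2 - 2 / θt) (1 / 2) with hL
  set U : ℝ := min (3 / pt) (3 / 2) with hU
  have hLU : L < U := by
    rw [hL, hU]
    have h2θ : 0 < 2 / θt := by positivity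
    refine max_lt (lt_min ?_ (by linarith)) (lt_min ?_ (by norm_num))
    · -- `3/2 - 2/θ̃ < 3/p̃ ⟺ θ̃(3/2 - 3/p̃) < 2`
      have h1 : 3 / 2 - 3 / pt < 2 / θt := by
        rw [lt_div_iff₀ hθt0, mul_comm]; exact hgap
      linarith
    · rw [lt_div_iff₀ hpt0]; linarith
  obtain ⟨x, hLx, hxU⟩ := exists_between hLU
  have hx12 : 1 / 2 < x := lt_of_le_of_lt (le_max_right _ _) hLx
  have hxθ : 3 / 2 - 2 / θt < x := lt_of_le_of_lt (le_max_left _ _) hLx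
  have hxpt : x < 3 / pt := lt_of_lt_of_le hxU (min_le_left _ _)
  have hx32 : x < 3 / 2 := lt_of_lt_of_le hxU (min_le_right _ _)
  have hx0 : 0 < x := by linarith
  set p' : ℝ := 3 / x with hp'
  have hp'0 : 0 < p' := by rw [hp']; positivity
  have h3p' : 3 / p' = x := by rw [hp']; field_simp
  refine ⟨a, pt, θt, p', ha1, ha3, has, hal, hpt0, ?_, ?_, ?_, hθt0, ?_, hconj1, hconj2⟩
  · -- `p̃ < p' ⟺ x < 3/p̃`
    rw [hp', lt_div_iff₀ hx0]
    rw [lt_div_iff₀ hpt0] at hxpt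
    linarith
  · rw [hp', le_div_iff₀ hx0]; linarith
  · rw [hp', div_le_iff₀ hx0]; linarith
  · rw [h3p']
    have h1 : 3 / 2 - x < 2 / θt := by linarith
    rw [lt_div_iff₀ hθt0] at h1
    linarith

/-! ## §3. Hölder's inequality twice on `]-1,0[ × B(0,1)` -/

/-- `x^a · x^{3-a} = x³` in `ℝ≥0∞` (`0 < a < 3`). [folklore] -/
private theorem rpow_mul_rpow_three {a : ℝ} (h0a : 0 < a) (ha3 : a < 3) (x : ℝ≥0∞) :
    x ^ a * x ^ (3 - a) = x ^ (3 : ℕ) := by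
  rw [← ENNReal.rpow_add_of_nonneg a (3 - a) h0a.le (by linarith),
    show a + (3 - a) = ((3 : ℕ) : ℝ) by push_cast; ring, ENNReal.rpow_natCast]

/-- **The two Hölder inequalities of the cubic estimate** (Appendix III: "use the Hölder
inequality in the following way `∫_B |v|³ ≤ (∫_B |v|^s)^λ (∫_B |v|^{p̃})^μ`. Integration in `t` …"):
for a measurable `w` on `]-1,0[ × B(0,1)` and exponents with `a/s + (3-a)/p̃ = 1`,
`a/l + (3-a)/θ̃ = 1`,
`∫∫ |w|³ ≤ (∫_t (∫_B |w|^s)^{l/s})^{a/l} (∫_t (∫_B |w|^{p̃})^{θ̃/p̃})^{(3-a)/θ̃}`.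
[cite: Seregin2023, Appendix III (pp. 25–26)] -/
theorem lintegral_cube_le_holder {w : ℝ → EuclideanSpace ℝ (Fin 3) → EuclideanSpace ℝ (Fin 3)}
    (hw : AEStronglyMeasurable (uncurry w)
      (volume.restrict (Ioo (-1 : ℝ) 0 ×ˢ ball (0 : EuclideanSpace ℝ (Fin 3)) 1)))
    {a s l pt θt : ℝ} (h1a : 1 < a) (ha3 : a < 3) (has : a < s) (hal : a < l) (hpt : 0 < pt)
    (hθt : 0 < θt) (hconj1 : a / s + (3 - a) / pt = 1) (hconj2 : a / l + (3 - a) / θt = 1) :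
    ∫⁻ z in Ioo (-1 : ℝ) 0 ×ˢ ball (0 : EuclideanSpace ℝ (Fin 3)) 1, ‖w z.1 z.2‖ₑ ^ (3 : ℕ) ≤
      (∫⁻ t in Ioo (-1 : ℝ) 0,
          (∫⁻ x in ball (0 : EuclideanSpace ℝ (Fin 3)) 1, ‖w t x‖ₑ ^ s) ^ (l / s)) ^ (a / l) *
        (∫⁻ t in Ioo (-1 : ℝ) 0,
          (∫⁻ x in ball (0 : EuclideanSpace ℝ (Fin 3)) 1, ‖w t x‖ₑ ^ pt) ^ (θt / pt)) ^
            ((3 - a) / θt) := by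
  set I : Set ℝ := Ioo (-1 : ℝ) 0 with hI
  set B : Set (EuclideanSpace ℝ (Fin 3)) := ball (0 : EuclideanSpace ℝ (Fin 3)) 1 with hB
  have h0a : 0 < a := by linarith
  have hs0 : 0 < s := by linarith
  have hl0 : 0 < l := by linarith
  have h3a : 0 < 3 - a := by linarith
  -- product structure of the restricted measure, measurability
  have hprod : (volume.restrict (I ×ˢ B) : Measure (ℝ × EuclideanSpace ℝ (Fin 3))) =
      (volume.restrict I).prod (volume.restrict B) := by
    rw [Measure.volume_eq_prod, Measure.prod_restrict]
  have hwm : AEStronglyMeasurable (uncurry w) ((volume.restrict I).prod (volume.restrict B)) := by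
    rw [← hprod]; exact hw
  have hFm : ∀ e : ℝ, AEMeasurable (fun z : ℝ × EuclideanSpace ℝ (Fin 3) => ‖w z.1 z.2‖ₑ ^ e)
      ((volume.restrict I).prod (volume.restrict B)) := fun e =>
    hwm.aemeasurable.enorm.pow_const e
  have hF3 : AEMeasurable (fun z : ℝ × EuclideanSpace ℝ (Fin 3) => ‖w z.1 z.2‖ₑ ^ (3 : ℕ))
      ((volume.restrict I).prod (volume.restrict B)) :=
    hwm.aemeasurable.enorm.pow_const _
  -- slices are measurable for a.e. `t`
  have hslice : ∀ᵐ t ∂(volume.restrict I), AEStronglyMeasurable (w t) (volume.restrict B) :=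
    hwm.prodMk_left
  -- ### Tonelli
  have hT : ∫⁻ z in I ×ˢ B, ‖w z.1 z.2‖ₑ ^ (3 : ℕ) = ∫⁻ t in I, ∫⁻ x in B, ‖w t x‖ₑ ^ (3 : ℕ) := by
    rw [Measure.volume_eq_prod, setLIntegral_prod _ (by rwa [← Measure.prod_restrict])]
  -- ### Hölder in `x`, slice-wise
  have hx : ∀ᵐ t ∂(volume.restrict I), ∫⁻ x in B, ‖w t x‖ₑ ^ (3 : ℕ) ≤
      (∫⁻ x in B, ‖w t x‖ₑ ^ s) ^ (a / s) * (∫⁻ x in B, ‖w t x‖ₑ ^ pt) ^ ((3 - a) / pt) := by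
    filter_upwards [hslice] with t ht
    have hpq : (s / a).HolderConjugate (pt / (3 - a)) :=
      ⟨by rw [inv_div, inv_div, inv_one]; exact hconj1, by positivity, by positivity⟩
    have hf : AEMeasurable (fun x => ‖w t x‖ₑ ^ a) (volume.restrict B) :=
      ht.aemeasurable.enorm.pow_const a
    have hg : AEMeasurable (fun x => ‖w t x‖ₑ ^ (3 - a)) (volume.restrict B) :=
      ht.aemeasurable.enorm.pow_const _
    have h := ENNReal.lintegral_mul_le_Lp_mul_Lq (volume.restrict B) hpq hf hg
    have e1 : ∀ x, ((fun x => ‖w t x‖ₑ ^ a) * fun x => ‖w t x‖ₑ ^ (3 - a)) x = ‖w t x‖ₑ ^ (3 : ℕ) :=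
      fun x => by simp only [Pi.mul_apply]; exact rpow_mul_rpow_three h0a ha3 _
    have e2 : ∀ x, (‖w t x‖ₑ ^ a) ^ (s / a) = ‖w t x‖ₑ ^ s := fun x => by
      rw [← ENNReal.rpow_mul]; congr 1; field_simp
    have e3 : ∀ x, (‖w t x‖ₑ ^ (3 - a)) ^ (pt / (3 - a)) = ‖w t x‖ₑ ^ pt := fun x => by
      rw [← ENNReal.rpow_mul]; congr 1; field_simp
    simp_rw [e1, e2, e3, one_div, inv_div] at h
    exact h
  -- ### Hölder in `t`
  have hpq2 : (l / a).HolderConjugate (θt / (3 - a)) :=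
    ⟨by rw [inv_div, inv_div, inv_one]; exact hconj2, by positivity, by positivity⟩
  have hFt : AEMeasurable (fun t => (∫⁻ x in B, ‖w t x‖ₑ ^ s) ^ (a / s)) (volume.restrict I) :=
    ((hFm s).lintegral_prod_right').pow_const _
  have hGt : AEMeasurable (fun t => (∫⁻ x in B, ‖w t x‖ₑ ^ pt) ^ ((3 - a) / pt))
      (volume.restrict I) :=
    ((hFm pt).lintegral_prod_right').pow_const _
  have h2 := ENNReal.lintegral_mul_le_Lp_mul_Lq (volume.restrict I) hpq2 hFt hGt
  have e4 : ∀ t, ((∫⁻ x in B, ‖w t x‖ₑ ^ s) ^ (a / s)) ^ (l / a) =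
      (∫⁻ x in B, ‖w t x‖ₑ ^ s) ^ (l / s) := fun t => by
    rw [← ENNReal.rpow_mul]; congr 1; field_simp
  have e5 : ∀ t, ((∫⁻ x in B, ‖w t x‖ₑ ^ pt) ^ ((3 - a) / pt)) ^ (θt / (3 - a)) =
      (∫⁻ x in B, ‖w t x‖ₑ ^ pt) ^ (θt / pt) := fun t => by
    rw [← ENNReal.rpow_mul]; congr 1; field_simp
  simp_rw [Pi.mul_apply, e4, e5, one_div, inv_div] at h2
  rw [hT]
  exact (lintegral_mono_ae hx).trans h2

/-! ## §4. The energy class bounds `‖w‖_{L^{θ̃}_t L^{p̃}_x(Q(1))}` — homogeneous form -/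

/-- Scalar multiples keep weak spatial gradients (the case `β = γ = 1` of the space–time
rescaling covariance `HasWeakSpatialGradientOn.stRescale`). [folklore] -/
private theorem hasWeakSpatialGradientOn_smul {Q : Opens (ℝ × EuclideanSpace ℝ (Fin 3))}
    {u : ℝ → EuclideanSpace ℝ (Fin 3) → EuclideanSpace ℝ (Fin 3)}
    {G : ℝ → EuclideanSpace ℝ (Fin 3) → EuclideanSpace ℝ (Fin 3) →L[ℝ] EuclideanSpace ℝ (Fin 3)}
    (h : HasWeakSpatialGradientOn Q u G) (c : ℝ) :
    HasWeakSpatialGradientOn Q (c • u) (c • G) := by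
  have h1 := h.stRescale c one_pos one_pos 0 0
  have hu : stPull 1 1 0 (0 : EuclideanSpace ℝ (Fin 3)) u = u := by
    funext t x; simp [stPull_apply]
  have hG : stPull 1 1 0 (0 : EuclideanSpace ℝ (Fin 3)) G = G := by
    funext t x; simp [stPull_apply]
  have hQ : stPreimage 1 1 0 (0 : EuclideanSpace ℝ (Fin 3)) Q = Q := by
    apply TopologicalSpace.Opens.ext
    ext z
    simp [stAffine]
  rw [hu, hG, mul_one, hQ] at h1
  exact h1

/-- **The energy class controls `L^{θ̃}_t L^{p̃}_x(Q(1))`, homogeneous form** (the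
Gagliardo–Nirenberg step of Appendix III, "`≤ c R^{κ/q} M^{1/q} (∫(∫(|∇v|² + R⁻²|v|²))^{3γq'})^{1/q'}`",
at `R = 1`): for subcritical `(p̃, θ̃)` (`θ̃ (3/2 - 3/p') < 2` for some `p' ∈ ]p̃, 6]`, `p' ≥ 2`)
there is `C₁` with `∫_{-1}^0 (∫_{B(1)} |w|^{p̃})^{θ̃/p̃} ≤ C₁ (1 + A + E)^{θ̃/2}` whenever
`∫_{B(1)} |w(t)|² ≤ A` for a.e. `t` and `∫_{Q(1)} |∇w|² ≤ E` — from the tree's unit-cylinder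
estimate `exists_mixedNorm_smallBall_le` (constants `A = E = 1`) applied to the normalised field
`w / (1 + A + E)^{1/2}`. [cite: Seregin2023, Appendix III (p. 26)] -/
theorem exists_mixedNorm_le_of_energy {pt θt p' : ℝ} (hpt : 0 < pt) (hptp : pt < p')
    (h2p : 2 ≤ p') (hp6 : p' ≤ 6) (hθt : 0 < θt) (hθq : θt * (3 / 2 - 3 / p') < 2) :
    ∃ C₁ : ℝ≥0, ∀ (w : ℝ → EuclideanSpace ℝ (Fin 3) → EuclideanSpace ℝ (Fin 3))
      (Gw : ℝ → EuclideanSpace ℝ (Fin 3) → EuclideanSpace ℝ (Fin 3) →L[ℝ] EuclideanSpace ℝ (Fin 3)),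
      HasWeakSpatialGradientOn
        (parabolicCylinderOpens 1 (0 : ℝ × EuclideanSpace ℝ (Fin 3))) w Gw →
      ∀ (A E : ℝ≥0∞), A ≠ ∞ → E ≠ ∞ →
      (∀ᵐ t ∂(volume.restrict (Ioo (-1 : ℝ) 0)),
        ∫⁻ x in ball (0 : EuclideanSpace ℝ (Fin 3)) 1, ‖w t x‖ₑ ^ 2 ≤ A) →
      (∫⁻ z in parabolicCylinder 1 (0 : ℝ × EuclideanSpace ℝ (Fin 3)),
        ENNReal.ofReal (frobeniusNormSq (Gw z.1 z.2)) ≤ E) →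
      ∫⁻ t in Ioo (-1 : ℝ) 0,
          (∫⁻ x in ball (0 : EuclideanSpace ℝ (Fin 3)) 1, ‖w t x‖ₑ ^ pt) ^ (θt / pt) ≤
        (C₁ : ℝ≥0∞) * (1 + A + E) ^ (θt / 2) := by
  obtain ⟨C₁, hC₁⟩ := exists_mixedNorm_smallBall_le 1 1 hpt hptp h2p hp6 hθt hθq
  refine ⟨C₁, fun w Gw hGw A E hA hE hslice hgrad => ?_⟩
  -- the normalisation `N = 1 + A + E`, `c = N^{-1/2}`
  set N : ℝ≥0∞ := 1 + A + E with hN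
  have hNtop : N ≠ ∞ := ENNReal.add_ne_top.2 ⟨ENNReal.add_ne_top.2 ⟨ENNReal.one_ne_top, hA⟩, hE⟩
  have hN1 : 1 ≤ N := by rw [hN, add_assoc]; exact le_self_add
  have hN0 : N ≠ 0 := (lt_of_lt_of_le zero_lt_one hN1).ne'
  have hNr : 0 < N.toReal := ENNReal.toReal_pos hN0 hNtop
  set c : ℝ := N.toReal ^ (-(1 / 2 : ℝ)) with hc
  have hcpos : 0 < c := Real.rpow_pos_of_pos hNr _
  have hcE : ENNReal.ofReal c = N ^ (-(1 / 2 : ℝ)) := by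
    rw [hc, ← ENNReal.ofReal_rpow_of_pos hNr, ENNReal.ofReal_toReal hNtop]
  have hc2 : ENNReal.ofReal c ^ 2 = N⁻¹ := by
    rw [hcE, ← ENNReal.rpow_natCast, ← ENNReal.rpow_mul]
    norm_num
    exact ENNReal.rpow_neg_one N
  have henc : ‖c‖ₑ = ENNReal.ofReal c := by
    rw [← Real.enorm_eq_ofReal hcpos.le]
  -- the normalised field
  set w' : ℝ → EuclideanSpace ℝ (Fin 3) → EuclideanSpace ℝ (Fin 3) := c • w with hw'
  set Gw' : ℝ → EuclideanSpace ℝ (Fin 3) → EuclideanSpace ℝ (Fin 3) →L[ℝ] EuclideanSpace ℝ (Fin 3) :=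
    c • Gw with hGw'
  have hGw' : HasWeakSpatialGradientOn
      (parabolicCylinderOpens 1 (0 : ℝ × EuclideanSpace ℝ (Fin 3))) w' Gw' :=
    hasWeakSpatialGradientOn_smul hGw c
  have hw'pt : ∀ t x, w' t x = c • w t x := fun t x => rfl
  have hpow : ∀ {e : ℝ}, 0 ≤ e → ∀ (t : ℝ) (x : EuclideanSpace ℝ (Fin 3)),
      ‖w' t x‖ₑ ^ e = ENNReal.ofReal c ^ e * ‖w t x‖ₑ ^ e := by
    intro e he t x
    rw [hw'pt, enorm_smul, henc, ENNReal.mul_rpow_of_nonneg _ _ he]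
  have hctop : ∀ {e : ℝ}, 0 ≤ e → ENNReal.ofReal c ^ e ≠ ∞ := fun he =>
    ENNReal.rpow_ne_top_of_nonneg he ENNReal.ofReal_ne_top
  -- the hypotheses of the unit-cylinder estimate for the normalised field
  have hAN : A ≤ N := by rw [hN]; exact le_add_right le_add_self
  have hEN : E ≤ N := le_add_self
  have hslice' : ∀ᵐ t ∂(volume.restrict (Ioo (-1 : ℝ) 0)),
      ∫⁻ x in ball (0 : EuclideanSpace ℝ (Fin 3)) 1, ‖w' t x‖ₑ ^ 2 ≤ ((1 : ℝ≥0) : ℝ≥0∞) := by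
    filter_upwards [hslice] with t ht
    have e1 : ∀ x, ‖w' t x‖ₑ ^ 2 = ENNReal.ofReal c ^ 2 * ‖w t x‖ₑ ^ 2 := fun x => by
      rw [hw'pt, enorm_smul, henc, mul_pow]
    simp_rw [e1]
    rw [lintegral_const_mul' _ _ (ENNReal.pow_ne_top ENNReal.ofReal_ne_top), hc2, ENNReal.coe_one]
    calc N⁻¹ * ∫⁻ x in ball (0 : EuclideanSpace ℝ (Fin 3)) 1, ‖w t x‖ₑ ^ 2 ≤ N⁻¹ * N := by
          gcongr; exact ht.trans hAN
      _ = 1 := ENNReal.inv_mul_cancel hN0 hNtop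
  have hgrad' : ∫⁻ z in parabolicCylinder 1 (0 : ℝ × EuclideanSpace ℝ (Fin 3)),
      ENNReal.ofReal (frobeniusNormSq (Gw' z.1 z.2)) ≤ ((1 : ℝ≥0) : ℝ≥0∞) := by
    have e1 : ∀ z : ℝ × EuclideanSpace ℝ (Fin 3), ENNReal.ofReal (frobeniusNormSq (Gw' z.1 z.2)) =
        ENNReal.ofReal c ^ 2 * ENNReal.ofReal (frobeniusNormSq (Gw z.1 z.2)) := fun z => by
      have : Gw' z.1 z.2 = c • Gw z.1 z.2 := rfl
      rw [this, frobeniusNormSq_smul, ENNReal.ofReal_mul (sq_nonneg c), ENNReal.ofReal_pow hcpos.le]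
    simp_rw [e1]
    rw [lintegral_const_mul' _ _ (ENNReal.pow_ne_top ENNReal.ofReal_ne_top), hc2, ENNReal.coe_one]
    calc N⁻¹ * ∫⁻ z in parabolicCylinder 1 (0 : ℝ × EuclideanSpace ℝ (Fin 3)),
        ENNReal.ofReal (frobeniusNormSq (Gw z.1 z.2)) ≤ N⁻¹ * N := by
          gcongr; exact hgrad.trans hEN
      _ = 1 := ENNReal.inv_mul_cancel hN0 hNtop
  -- the estimate for the normalised field, and back
  have hmain := hC₁ w' Gw' hGw' hslice' hgrad' 1 ⟨one_pos, le_rfl⟩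
  rw [Real.one_rpow, ENNReal.ofReal_one, mul_one] at hmain
  have hθpt : 0 ≤ θt / pt := div_nonneg hθt.le hpt.le
  have e2 : ∀ t, (∫⁻ x in ball (0 : EuclideanSpace ℝ (Fin 3)) 1, ‖w' t x‖ₑ ^ pt) ^ (θt / pt) =
      ENNReal.ofReal c ^ θt *
        (∫⁻ x in ball (0 : EuclideanSpace ℝ (Fin 3)) 1, ‖w t x‖ₑ ^ pt) ^ (θt / pt) := by
    intro t
    simp_rw [hpow hpt.le]
    rw [lintegral_const_mul' _ _ (hctop hpt.le), ENNReal.mul_rpow_of_nonneg _ _ hθpt,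
      ← ENNReal.rpow_mul, mul_div_cancel₀ θt hpt.ne']
  simp_rw [e2] at hmain
  rw [lintegral_const_mul' _ _ (hctop hθt.le)] at hmain
  -- divide by `c^{θ̃} = N^{-θ̃/2}`
  have hK0 : ENNReal.ofReal c ^ θt ≠ 0 :=
    (ENNReal.rpow_pos (ENNReal.ofReal_pos.2 hcpos) ENNReal.ofReal_ne_top).ne'
  have hdiv : ∫⁻ t in Ioo (-1 : ℝ) 0,
      (∫⁻ x in ball (0 : EuclideanSpace ℝ (Fin 3)) 1, ‖w t x‖ₑ ^ pt) ^ (θt / pt) ≤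
        (C₁ : ℝ≥0∞) / ENNReal.ofReal c ^ θt := by
    rw [ENNReal.le_div_iff_mul_le (Or.inl hK0) (Or.inl (hctop hθt.le)), mul_comm]
    exact hmain
  refine hdiv.trans_eq ?_
  rw [div_eq_mul_inv, ← ENNReal.rpow_neg, hcE, ← ENNReal.rpow_mul]
  congr 2
  ring

/-! ## §5. The cubic estimate -/

/-- The unit backward cylinder at the origin as a product. [folklore] -/
private theorem parabolicCylinder_one_zero :
    parabolicCylinder 1 (0 : ℝ × EuclideanSpace ℝ (Fin 3)) =
      Ioo (-1 : ℝ) 0 ×ˢ ball (0 : EuclideanSpace ℝ (Fin 3)) 1 := by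
  rw [SuitableCompactness.parabolicCylinder_zero]; norm_num

/-- **The cubic estimate at radius `1`** (Appendix III: Hölder in `x` and `t`, then the energy
class): with the exponents of `exists_exponents`,
`C(w, 1) ≤ K₀ (∫_{-1}^0 (∫_{B(1)} |w|^s)^{l/s})^{a/l} (1 + A + E)^{(3-a)/2}` whenever
`∫_{B(1)} |w(t)|² ≤ A` for a.e. `t ∈ ]-1,0[` and `∫_{Q(1)} |∇w|² ≤ E`.
[cite: Seregin2023, Appendix III (pp. 25–26)] -/
theorem exists_cubic_estimate_one {s l a pt θt p' : ℝ} (h1a : 1 < a) (ha3 : a < 3) (has : a < s)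
    (hal : a < l) (hpt : 0 < pt) (hptp : pt < p') (h2p : 2 ≤ p') (hp6 : p' ≤ 6) (hθt : 0 < θt)
    (hθq : θt * (3 / 2 - 3 / p') < 2) (hconj1 : a / s + (3 - a) / pt = 1)
    (hconj2 : a / l + (3 - a) / θt = 1) :
    ∃ K₀ : ℝ≥0, ∀ (w : ℝ → EuclideanSpace ℝ (Fin 3) → EuclideanSpace ℝ (Fin 3))
      (Gw : ℝ → EuclideanSpace ℝ (Fin 3) → EuclideanSpace ℝ (Fin 3) →L[ℝ] EuclideanSpace ℝ (Fin 3)),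
      HasWeakSpatialGradientOn
        (parabolicCylinderOpens 1 (0 : ℝ × EuclideanSpace ℝ (Fin 3))) w Gw →
      ∀ (A E : ℝ≥0∞), A ≠ ∞ → E ≠ ∞ →
      (∀ᵐ t ∂(volume.restrict (Ioo (-1 : ℝ) 0)),
        ∫⁻ x in ball (0 : EuclideanSpace ℝ (Fin 3)) 1, ‖w t x‖ₑ ^ 2 ≤ A) →
      (∫⁻ z in parabolicCylinder 1 (0 : ℝ × EuclideanSpace ℝ (Fin 3)),
        ENNReal.ofReal (frobeniusNormSq (Gw z.1 z.2)) ≤ E) →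
      cknC 1 (0 : ℝ × EuclideanSpace ℝ (Fin 3)) w ≤
        (K₀ : ℝ≥0∞) *
          (∫⁻ t in Ioo (-1 : ℝ) 0,
              (∫⁻ x in ball (0 : EuclideanSpace ℝ (Fin 3)) 1, ‖w t x‖ₑ ^ s) ^ (l / s)) ^ (a / l) *
          (1 + A + E) ^ ((3 - a) / 2) := by
  obtain ⟨C₁, hC₁⟩ := exists_mixedNorm_le_of_energy hpt hptp h2p hp6 hθt hθq
  have h3a : 0 < 3 - a := by linarith
  have hexp : 0 ≤ (3 - a) / θt := div_nonneg h3a.le hθt.le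
  refine ⟨C₁ ^ ((3 - a) / θt), fun w Gw hGw A E hA hE hslice hgrad => ?_⟩
  -- measurability on the cylinder
  have hsub : Ioo (-1 : ℝ) 0 ×ˢ ball (0 : EuclideanSpace ℝ (Fin 3)) 1 ⊆
      (parabolicCylinderOpens 1 (0 : ℝ × EuclideanSpace ℝ (Fin 3)) :
        Set (ℝ × EuclideanSpace ℝ (Fin 3))) := by
    rw [coe_parabolicCylinderOpens, parabolicCylinder_one_zero]
  have hw : AEStronglyMeasurable (uncurry w)
      (volume.restrict (Ioo (-1 : ℝ) 0 ×ˢ ball (0 : EuclideanSpace ℝ (Fin 3)) 1)) :=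
    (hGw.locallyIntegrableOn.mono_set hsub).aestronglyMeasurable
  -- `C(w,1)` is the cube integral
  have hC : cknC 1 (0 : ℝ × EuclideanSpace ℝ (Fin 3)) w =
      ∫⁻ z in Ioo (-1 : ℝ) 0 ×ˢ ball (0 : EuclideanSpace ℝ (Fin 3)) 1, ‖w z.1 z.2‖ₑ ^ (3 : ℕ) := by
    rw [cknC, ENNReal.ofReal_one, one_pow, inv_one, one_mul, parabolicCylinder_one_zero]
  rw [hC]
  refine (lintegral_cube_le_holder hw h1a ha3 has hal hpt hθt hconj1 hconj2).trans ?_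
  have h2 := ENNReal.rpow_le_rpow (hC₁ w Gw hGw A E hA hE hslice hgrad) hexp
  refine (mul_le_mul' le_rfl h2).trans_eq ?_
  rw [ENNReal.mul_rpow_of_nonneg _ _ hexp, ← ENNReal.rpow_mul, ENNReal.coe_rpow_of_nonneg _ hexp,
    show θt / 2 * ((3 - a) / θt) = (3 - a) / 2 by field_simp]
  ring

/-- **The cubic estimate** (Appendix III, all cases at once): for `1 ≤ s`, `1 ≤ l`, `κ(s,l) < l`
there are `a ∈ ]1, 3[`, `a < l`, and `K₀` such that every field `v` with a weak spatial gradient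
`G` on `Q(1)` satisfies, for all `0 < R ≤ 1` with `A(v,R), E(v,R) < ∞`,
`C(v, R) ≤ K₀ (M^{s,l}_κ(v, R))^{a/l} (1 + A(v, R) + E(v, R))^{(3-a)/2}` — the unit-radius
estimate transported by the Navier–Stokes scaling `v ↦ R v(R² s, R y)` (`C`, `A`, `E`, `M^{s,l}_κ`
are scale invariant). [cite: Seregin2023, Appendix III (pp. 25–26)] -/
theorem exists_cubic_estimate {s l : ℝ} (hs : 1 ≤ s) (hl : 1 ≤ l) (hκ : kappa s l < l) :
    ∃ (a : ℝ) (K₀ : ℝ≥0), 1 < a ∧ a < 3 ∧ a < l ∧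
      ∀ (v : ℝ → EuclideanSpace ℝ (Fin 3) → EuclideanSpace ℝ (Fin 3))
        (G : ℝ → EuclideanSpace ℝ (Fin 3) → EuclideanSpace ℝ (Fin 3) →L[ℝ] EuclideanSpace ℝ (Fin 3)),
        HasWeakSpatialGradientOn
          (parabolicCylinderOpens 1 (0 : ℝ × EuclideanSpace ℝ (Fin 3))) v G →
        ∀ R ∈ Ioc (0 : ℝ) 1,
          cknAEss R (0 : ℝ × EuclideanSpace ℝ (Fin 3)) v ≠ ∞ →
          cknE R (0 : ℝ × EuclideanSpace ℝ (Fin 3)) G ≠ ∞ →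
          cknC R (0 : ℝ × EuclideanSpace ℝ (Fin 3)) v ≤
            (K₀ : ℝ≥0∞) *
              morreyM (kappa s l) s l (0 : ℝ × EuclideanSpace ℝ (Fin 3)) v R ^ (a / l) *
              (1 + cknAEss R (0 : ℝ × EuclideanSpace ℝ (Fin 3)) v +
                cknE R (0 : ℝ × EuclideanSpace ℝ (Fin 3)) G) ^ ((3 - a) / 2) := by
  have hs0 : 0 < s := by linarith
  have hl0 : 0 < l := by linarith
  obtain ⟨a, pt, θt, p', h1a, ha3, has, hal, hpt, hptp, h2p, hp6, hθt, hθq, hconj1, hconj2⟩ :=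
    exists_exponents hs hl hκ
  obtain ⟨K₀, hK₀⟩ :=
    exists_cubic_estimate_one h1a ha3 has hal hpt hptp h2p hp6 hθt hθq hconj1 hconj2
  refine ⟨a, K₀, h1a, ha3, hal, fun v G hG R hR hA hE => ?_⟩
  -- the zoomed field `w = R v(R² s, R y)` and its gradient
  set w : ℝ → EuclideanSpace ℝ (Fin 3) → EuclideanSpace ℝ (Fin 3) :=
    R • stPull (R ^ 2) R 0 (0 : EuclideanSpace ℝ (Fin 3)) v with hw
  set Gw : ℝ → EuclideanSpace ℝ (Fin 3) → EuclideanSpace ℝ (Fin 3) →L[ℝ] EuclideanSpace ℝ (Fin 3) :=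
    (R * R) • stPull (R ^ 2) R 0 (0 : EuclideanSpace ℝ (Fin 3)) G with hGw
  have hGw' : HasWeakSpatialGradientOn
      (parabolicCylinderOpens 1 (0 : ℝ × EuclideanSpace ℝ (Fin 3))) w Gw := by
    have h := zoom_hasWeakSpatialGradientOn (lam := R) (fl := 1) hR.1 hR.2 one_pos le_rfl hG
    simp only [mul_one] at h
    exact h
  have hslice : ∀ᵐ t ∂(volume.restrict (Ioo (-1 : ℝ) 0)),
      ∫⁻ x in ball (0 : EuclideanSpace ℝ (Fin 3)) 1, ‖w t x‖ₑ ^ 2 ≤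
        cknAEss R (0 : ℝ × EuclideanSpace ℝ (Fin 3)) v := by
    have hA1 : weightedA (fun _ => (1 : ℝ)) R (0 : ℝ × EuclideanSpace ℝ (Fin 3)) v ≤
        cknAEss R (0 : ℝ × EuclideanSpace ℝ (Fin 3)) v := (weightedA_one hR.1 _ v).le
    have h := zoom_slice_energy_le (lam := R) hR.1 (f := fun _ => (1 : ℝ)) one_pos le_rfl hA1
    simp only [mul_one] at h
    exact h
  have hgrad : ∫⁻ z in parabolicCylinder 1 (0 : ℝ × EuclideanSpace ℝ (Fin 3)),
      ENNReal.ofReal (frobeniusNormSq (Gw z.1 z.2)) ≤ cknE R (0 : ℝ × EuclideanSpace ℝ (Fin 3)) G := by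
    have h := zoom_grad_le (lam := R) hR.1 (f := fun _ => (1 : ℝ)) one_pos le_rfl (G := G)
    rw [weightedE_one hR.1] at h
    simp only [mul_one] at h
    exact h
  -- scale invariance of `C` and of `M^{s,l}_κ`
  have hCz : cknC 1 (0 : ℝ × EuclideanSpace ℝ (Fin 3)) w = cknC R (0 : ℝ × EuclideanSpace ℝ (Fin 3)) v := by
    have h := cknC_zoom hR.1 one_pos (0 : ℝ × EuclideanSpace ℝ (Fin 3)) v
    simp only [Prod.fst_zero, Prod.snd_zero, one_mul, Prod.mk_zero_zero] at h
    exact h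
  have hMz : ∫⁻ t in Ioo (-1 : ℝ) 0,
      (∫⁻ x in ball (0 : EuclideanSpace ℝ (Fin 3)) 1, ‖w t x‖ₑ ^ s) ^ (l / s) =
        morreyM (kappa s l) s l (0 : ℝ × EuclideanSpace ℝ (Fin 3)) v R := by
    have h := zoom_floor_eq (lam := R) hR.1 (f := fun _ => (1 : ℝ)) one_pos hs0 hl0 v
    simp only [mul_one, Real.sqrt_one, Real.one_rpow, ENNReal.ofReal_one, one_mul] at h
    exact h
  have h := hK₀ w Gw hGw' _ _ hA hE hslice hgrad
  rwa [hCz, hMz] at h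

/-! ## §6. Bounded `M^{s,l}_κ` ⇒ bounded scaled energies -/

/-- `x^e ≤ 1 + x` in `ℝ≥0∞` for `0 ≤ e ≤ 1`. [folklore] -/
private theorem rpow_le_one_add {e : ℝ} (he0 : 0 ≤ e) (he1 : e ≤ 1) (x : ℝ≥0∞) :
    x ^ e ≤ 1 + x := by
  rcases le_total x 1 with h | h
  · exact (ENNReal.rpow_le_one h he0).trans le_self_add
  · calc x ^ e ≤ x ^ (1 : ℝ) := ENNReal.rpow_le_rpow_of_exponent_le h he1
      _ = x := ENNReal.rpow_one x
      _ ≤ 1 + x := le_add_self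

/-- `D^{2/3} C^{1/3} ≤ 1 + C + D` in `ℝ≥0∞`. [folklore] -/
private theorem rpow_two_thirds_mul_rpow_one_third_le_one_add (C D : ℝ≥0∞) :
    D ^ (2 / 3 : ℝ) * C ^ (1 / 3 : ℝ) ≤ 1 + C + D := by
  calc D ^ (2 / 3 : ℝ) * C ^ (1 / 3 : ℝ) ≤ (C + D) ^ (2 / 3 : ℝ) * (C + D) ^ (1 / 3 : ℝ) := by
        gcongr
        · exact le_add_self
        · exact le_self_add
    _ = C + D := by
        rw [← ENNReal.rpow_add_of_nonneg _ _ (by norm_num) (by norm_num)]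
        norm_num
    _ ≤ 1 + C + D := by rw [add_assoc]; exact le_add_self

/-- **Seregin 2023, Thm 1.1 — the content: a bounded generalised Morrey quantity bounds the scaled
energies** ("a sufficient condition for the point `z = 0` to be a Type I blowup", p. 3; [8], [9]).
Let `(v, q)` be a suitable weak solution in `Q = Q(1)` with a weak spatial gradient `G`, let
`1 ≤ s`, `1 ≤ l`, `κ(s,l) < l`, `M = sup_{0<R<1} M^{s,l}_κ(v,R) < ∞` and `𝓔(1) < ∞`. Then
`sup_{0 < r ≤ 1} 𝓔(r) < ∞`, `𝓔 = E + A + D`. Proof: the cubic estimate `exists_cubic_estimate`,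
the local energy inequality `Seregin2020.localEnergyBound_top` and Young's inequality give the
cubic step `C(r) ≤ δ₀ (C(6r) + D(6r)) + Φ`; with the pressure decay estimate
(`seregin_sverak_pressure_decay_holds`) the iteration
`exists_bound_of_cubic_step_at_of_pressure_decay` bounds `C + D` on `]0, 1/2]`, and
`Seregin2020.scaledEnergies_bounded_of_cknC_le_unif` bounds `A + E + C + D` on `]0, 1/4]`; on
`[1/4, 1]` the energies are bounded by `16 𝓔(1)`. [cite: Seregin2023, Thm 1.1 (p. 3), Appendix III (pp. 25–26)] -/
theorem exists_energySumEss_le {s l : ℝ} (hs : 1 ≤ s) (hl : 1 ≤ l) (hκ : kappa s l < l)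
    {v : ℝ → EuclideanSpace ℝ (Fin 3) → EuclideanSpace ℝ (Fin 3)}
    {q : ℝ → EuclideanSpace ℝ (Fin 3) → ℝ}
    {G : ℝ → EuclideanSpace ℝ (Fin 3) → EuclideanSpace ℝ (Fin 3) →L[ℝ] EuclideanSpace ℝ (Fin 3)}
    (hv : IsSuitableWeakSolutionInBall 1 0 v q)
    (hG : HasWeakSpatialGradientOn
      (parabolicCylinderOpens 1 (0 : ℝ × EuclideanSpace ℝ (Fin 3))) v G)
    (hM : morreySup s l v < ∞) (h1 : energySumEss 1 v q G < ∞) :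
    ∃ K : ℝ≥0∞, K < ∞ ∧ ∀ r ∈ Ioc (0 : ℝ) 1, energySumEss r v q G ≤ K := by
  set z0 : ℝ × EuclideanSpace ℝ (Fin 3) := 0 with hz0
  set Q1 : Opens (ℝ × EuclideanSpace ℝ (Fin 3)) := parabolicCylinderOpens 1 z0 with hQ1
  have hsw : IsSuitableWeakSolutionOn Q1 1 0 v q := hv.1
  have hs0 : 0 < s := by linarith
  have hl0 : 0 < l := by linarith
  -- ### the constants
  obtain ⟨a, K₀, h1a, ha3, hal, hcubic⟩ := exists_cubic_estimate hs hl hκ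
  have h0a : 0 < a := by linarith
  obtain ⟨cp, hcp⟩ := seregin_sverak_pressure_decay_holds
  obtain ⟨δ₀, hδ₀, A₁, A₂, hiter⟩ := exists_bound_of_cubic_step_at_of_pressure_decay cp
  obtain ⟨c₁, c₂, c₃, hLEB⟩ := Seregin2020.localEnergyBound_top
  -- ### finiteness at the top scale and below
  have hE1 : cknE 1 z0 G ≠ ∞ := by
    refine (lt_of_le_of_lt ?_ h1).ne
    unfold energySumEss; exact le_add_right le_self_add
  have hA1 : cknAEss 1 z0 v ≠ ∞ := by
    refine (lt_of_le_of_lt ?_ h1).ne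
    unfold energySumEss; exact le_add_right le_add_self
  have hD1 : cknD 1 z0 q ≠ ∞ := by
    refine (lt_of_le_of_lt ?_ h1).ne
    unfold energySumEss; exact le_add_self
  have hcyl : ∀ R : ℝ, 0 < R → R ≤ 1 →
      parabolicCylinder R z0 ⊆ (Q1 : Set (ℝ × EuclideanSpace ℝ (Fin 3))) := fun R hR hR1 => by
    rw [hQ1, coe_parabolicCylinderOpens]; exact parabolicCylinder_mono hR.le hR1 z0
  have hAfin : ∀ R ∈ Ioc (0 : ℝ) 1, cknAEss R z0 v ≠ ∞ := by
    intro R hR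
    refine ne_top_of_le_ne_top (ENNReal.mul_ne_top ENNReal.ofReal_ne_top hA1)
      (cknAEss_le_mul_of_subset one_pos hR.1 (Ioo_subset_Ioo ?_ le_rfl) (ball_subset_ball hR.2) v)
    have : R ^ 2 ≤ 1 ^ 2 := pow_le_pow_left₀ hR.1.le hR.2 2
    linarith
  have hEfin : ∀ R ∈ Ioc (0 : ℝ) 1, cknE R z0 G ≠ ∞ := fun R hR =>
    ne_top_of_le_ne_top (ENNReal.mul_ne_top ENNReal.ofReal_ne_top hE1)
      (cknE_le_mul_of_subset one_pos hR.1 (parabolicCylinder_mono hR.1.le hR.2 z0) G)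
  have hDfin : ∀ R ∈ Ioc (0 : ℝ) 1, cknD R z0 q ≠ ∞ := fun R hR =>
    ne_top_of_le_ne_top (ENNReal.mul_ne_top (ENNReal.pow_ne_top ENNReal.ofReal_ne_top) hD1)
      (cknD_le_mul_of_subset one_pos hR.1 (parabolicCylinder_mono hR.1.le hR.2 z0) q)
  have hMtop : morreySup s l v ≠ ∞ := hM.ne
  -- ### the cubic step
  set β : ℝ := (3 - a) / 2 with hβ
  have hβ0 : 0 < β := by rw [hβ]; linarith
  have hβ1 : β < 1 := by rw [hβ]; linarith
  set csum : ℝ≥0∞ := (c₁ : ℝ≥0∞) + c₂ + c₃ with hcsum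
  have hcsumtop : csum ≠ ∞ := ENNReal.add_ne_top.2 ⟨ENNReal.add_ne_top.2
    ⟨ENNReal.coe_ne_top, ENNReal.coe_ne_top⟩, ENNReal.coe_ne_top⟩
  set K₁ : ℝ≥0∞ := (K₀ : ℝ≥0∞) * morreySup s l v ^ (a / l) * (9 * (1 + csum)) ^ β with hK₁
  have hK₁top : K₁ ≠ ∞ := by
    refine ENNReal.mul_ne_top (ENNReal.mul_ne_top ENNReal.coe_ne_top
      (ENNReal.rpow_ne_top_of_nonneg (by positivity) hMtop)) ?_
    exact ENNReal.rpow_ne_top_of_nonneg hβ0.le (ENNReal.mul_ne_top (by norm_num)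
      (ENNReal.add_ne_top.2 ⟨ENNReal.one_ne_top, hcsumtop⟩))
  have hδ0' : (δ₀ : ℝ≥0∞) ≠ 0 := by exact_mod_cast hδ₀.ne'
  set Φ : ℝ≥0∞ := (δ₀ : ℝ≥0∞) + (K₁ * (δ₀ : ℝ≥0∞)⁻¹ ^ β) ^ (1 / (1 - β)) with hΦ
  have hΦtop : Φ ≠ ∞ := by
    refine ENNReal.add_ne_top.2 ⟨ENNReal.coe_ne_top, ?_⟩
    refine ENNReal.rpow_ne_top_of_nonneg (div_nonneg zero_le_one (by linarith)) ?_
    exact ENNReal.mul_ne_top hK₁top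
      (ENNReal.rpow_ne_top_of_nonneg hβ0.le (ENNReal.inv_ne_top.2 hδ0'))
  have hstep : ∀ r : ℝ, 0 < r → 6 * r ≤ 1 / 2 →
      cknC r z0 v ≤ δ₀ * (cknC (6 * r) z0 v + cknD (6 * r) z0 q) + Φ := by
    intro r hr h6r
    have hr1 : r ≤ 1 := by linarith
    have hrlt1 : r < 1 := by linarith
    have h2r : 2 * r ≤ 1 := by linarith
    set X : ℝ≥0∞ := cknC (6 * r) z0 v with hX
    set Y : ℝ≥0∞ := cknD (6 * r) z0 q with hY
    set S : ℝ≥0∞ := 1 + X + Y with hS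
    -- the cubic estimate at radius `r`
    have hc := hcubic v G hG r ⟨hr, hr1⟩ (hAfin r ⟨hr, hr1⟩) (hEfin r ⟨hr, hr1⟩)
    have hMr : morreyM (kappa s l) s l z0 v r ≤ morreySup s l v := morreyM_le_morreySup ⟨hr, hrlt1⟩
    -- the local energy inequality at radius `2r`
    have hle := hLEB Q1 v q G hsw hG z0 (2 * r) (by positivity) (hcyl _ (by positivity) h2r)
    rw [show 2 * r / 2 = r by ring] at hle
    -- `C(2r) ≤ 9 C(6r)`, `D(2r) ≤ 9 D(6r)`
    have h6 : (0 : ℝ) < 6 * r := by positivity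
    have h2 : (0 : ℝ) < 2 * r := by positivity
    have hsub : parabolicCylinder (2 * r) z0 ⊆ parabolicCylinder (6 * r) z0 :=
      parabolicCylinder_mono h2.le (by linarith) z0
    have hratio : ENNReal.ofReal (6 * r / (2 * r)) ^ 2 = 9 := by
      rw [show 6 * r / (2 * r) = 3 by field_simp; ring, ENNReal.ofReal_ofNat]; norm_num
    have hC2 : cknC (2 * r) z0 v ≤ 9 * X := by
      have h := Seregin2020.cknC_le_mul_of_subset h6 h2 hsub v
      rwa [hratio] at h
    have hD2 : cknD (2 * r) z0 q ≤ 9 * Y := by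
      have h := cknD_le_mul_of_subset h6 h2 hsub q
      rwa [hratio] at h
    -- `1 + A(r) + E(r) ≤ 9 (1 + c₁ + c₂ + c₃) S`
    have hT : 1 + cknC (2 * r) z0 v + cknD (2 * r) z0 q ≤ 9 * S := by
      calc 1 + cknC (2 * r) z0 v + cknD (2 * r) z0 q ≤ 9 * 1 + 9 * X + 9 * Y := by
            gcongr
            rw [mul_one]; norm_num
        _ = 9 * S := by rw [hS]; ring
    have hAE : 1 + cknAEss r z0 v + cknE r z0 G ≤ 9 * (1 + csum) * S := by
      have hT1 := rpow_le_one_add (by norm_num : (0 : ℝ) ≤ 2 / 3) (by norm_num : (2 / 3 : ℝ) ≤ 1)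
        (cknC (2 * r) z0 v)
      have hT2 := rpow_two_thirds_mul_rpow_one_third_le_one_add (cknC (2 * r) z0 v) (cknD (2 * r) z0 q)
      have hT3 : cknC (2 * r) z0 v ≤ 1 + cknC (2 * r) z0 v + cknD (2 * r) z0 q :=
        le_add_right le_add_self
      have hT1' : cknC (2 * r) z0 v ^ (2 / 3 : ℝ) ≤ 1 + cknC (2 * r) z0 v + cknD (2 * r) z0 q :=
        hT1.trans le_self_add
      calc 1 + cknAEss r z0 v + cknE r z0 G = 1 + (cknAEss r z0 v + cknE r z0 G) := add_assoc _ _ _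
        _ ≤ 1 + ((c₁ : ℝ≥0∞) * cknC (2 * r) z0 v ^ (2 / 3 : ℝ) + c₂ * cknC (2 * r) z0 v +
            c₃ * (cknD (2 * r) z0 q ^ (2 / 3 : ℝ) * cknC (2 * r) z0 v ^ (1 / 3 : ℝ))) := by
            gcongr
        _ ≤ 1 * (9 * S) + ((c₁ : ℝ≥0∞) * (9 * S) + c₂ * (9 * S) + c₃ * (9 * S)) := by
            refine add_le_add ?_ (add_le_add (add_le_add (mul_le_mul' le_rfl (hT1'.trans hT))
              (mul_le_mul' le_rfl (hT3.trans hT))) (mul_le_mul' le_rfl (hT2.trans hT)))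
            rw [one_mul]
            calc (1 : ℝ≥0∞) ≤ 9 * 1 := by norm_num
              _ ≤ 9 * S := by gcongr; rw [hS, add_assoc]; exact le_self_add
        _ = 9 * (1 + csum) * S := by rw [hcsum]; ring
    -- `C(r) ≤ K₁ S^β`
    have hCr : cknC r z0 v ≤ K₁ * S ^ β := by
      calc cknC r z0 v ≤ (K₀ : ℝ≥0∞) * morreyM (kappa s l) s l z0 v r ^ (a / l) *
            (1 + cknAEss r z0 v + cknE r z0 G) ^ ((3 - a) / 2) := hc
        _ ≤ (K₀ : ℝ≥0∞) * morreySup s l v ^ (a / l) * (9 * (1 + csum) * S) ^ ((3 - a) / 2) := by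
            gcongr
        _ = K₁ * S ^ β := by
            rw [hK₁, hβ, ENNReal.mul_rpow_of_nonneg _ S (by linarith : (0 : ℝ) ≤ (3 - a) / 2)]
            ring
    -- Young's inequality
    have hYoung := Seregin2020.rpow_le_mul_add hβ0 hβ1 K₁ S hδ0' ENNReal.coe_ne_top
    calc cknC r z0 v ≤ K₁ * S ^ β := hCr
      _ ≤ (δ₀ : ℝ≥0∞) * S + (K₁ * (δ₀ : ℝ≥0∞)⁻¹ ^ β) ^ (1 / (1 - β)) := hYoung
      _ = δ₀ * (X + Y) + Φ := by rw [hS, hΦ]; ring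
  -- ### monotonicity and pressure decay
  have hmonoC : ∀ r' R : ℝ, 0 < r' → r' ≤ R → R ≤ 1 / 2 →
      cknC r' z0 v ≤ ENNReal.ofReal (R / r') ^ 2 * cknC R z0 v := fun r' R hr' hrR _ =>
    Seregin2020.cknC_le_mul_of_subset (hr'.trans_le hrR) hr' (parabolicCylinder_mono hr'.le hrR z0) v
  have hmonoD : ∀ r' R : ℝ, 0 < r' → r' ≤ R → R ≤ 1 / 2 →
      cknD r' z0 q ≤ ENNReal.ofReal (R / r') ^ 2 * cknD R z0 q := fun r' R hr' hrR _ =>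
    cknD_le_mul_of_subset (hr'.trans_le hrR) hr' (parabolicCylinder_mono hr'.le hrR z0) q
  have hPD : ∀ ϱ ρ : ℝ, 0 < ϱ → ϱ ≤ ρ → ρ ≤ 1 / 2 →
      cknD ϱ z0 q ≤ cp * (ENNReal.ofReal (ϱ / ρ) * cknD ρ z0 q +
        ENNReal.ofReal ((ρ / ϱ) ^ 2) * cknC ρ z0 v) := fun ϱ ρ hϱ hϱρ hρ =>
    hcp Q1 v q hsw.distributional z0 ρ ϱ hϱ hϱρ (hcyl ρ (hϱ.trans_le hϱρ) (by linarith))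
  -- ### the iteration: `C + D` bounded on `]0, 1/2]`
  have hhalf : (1 / 2 : ℝ) ∈ Ioc (0 : ℝ) 1 := ⟨by norm_num, by norm_num⟩
  have hbound := hiter (fun ρ => cknC ρ z0 v) (fun ρ => cknD ρ z0 q) (1 / 2) Φ (by norm_num)
    hmonoC hmonoD hstep hPD
  set Bnd : ℝ≥0∞ := (A₁ : ℝ≥0∞) * (cknC (1 / 2) z0 v + cknD (1 / 2) z0 q) + A₂ * Φ with hBnd
  have hChalf : cknC (1 / 2) z0 v ≠ ∞ := by
    have hc := hcubic v G hG (1 / 2) hhalf (hAfin _ hhalf) (hEfin _ hhalf)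
    refine ne_top_of_le_ne_top ?_ hc
    refine ENNReal.mul_ne_top (ENNReal.mul_ne_top ENNReal.coe_ne_top
      (ENNReal.rpow_ne_top_of_nonneg (by positivity) ?_)) ?_
    · exact ne_top_of_le_ne_top hMtop (morreyM_le_morreySup ⟨by norm_num, by norm_num⟩)
    · exact ENNReal.rpow_ne_top_of_nonneg (by linarith) (ENNReal.add_ne_top.2
        ⟨ENNReal.add_ne_top.2 ⟨ENNReal.one_ne_top, hAfin _ hhalf⟩, hEfin _ hhalf⟩)
  have hDhalf : cknD (1 / 2) z0 q ≠ ∞ := hDfin _ hhalf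
  have hBndtop : Bnd ≠ ∞ := ENNReal.add_ne_top.2
    ⟨ENNReal.mul_ne_top ENNReal.coe_ne_top (ENNReal.add_ne_top.2 ⟨hChalf, hDhalf⟩),
      ENNReal.mul_ne_top ENNReal.coe_ne_top hΦtop⟩
  -- ### Seregin's lemma: `A + E + C + D` bounded on `]0, 1/4]`
  obtain ⟨K, hK⟩ := Seregin2020.scaledEnergies_bounded_of_cknC_le_unif Bnd.toNNReal
    (cknD (1 / 2) z0 q).toNNReal
  have hK' := hK Q1 v q G hsw hG z0 (1 / 2) (by norm_num) (hcyl _ (by norm_num) (by norm_num))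
    (by rw [ENNReal.coe_toNNReal hDhalf])
    (fun r hr => by rw [ENNReal.coe_toNNReal hBndtop]; exact le_self_add.trans (hbound r hr))
  -- ### conclusion
  refine ⟨(K : ℝ≥0∞) + 16 * energySumEss 1 v q G,
    ENNReal.add_lt_top.2 ⟨ENNReal.coe_lt_top, ENNReal.mul_lt_top (by norm_num) h1⟩, fun r hr => ?_⟩
  by_cases hr4 : r ≤ 1 / 4
  · have h := hK' r ⟨hr.1, by linarith⟩
    calc energySumEss r v q G = (cknAEss r z0 v + cknE r z0 G) + cknD r z0 q := by
          unfold energySumEss; rw [hz0]; ring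
      _ ≤ (cknAEss r z0 v + cknE r z0 G + cknC r z0 v) + cknD r z0 q :=
          add_le_add le_self_add le_rfl
      _ ≤ K := h
      _ ≤ (K : ℝ≥0∞) + 16 * energySumEss 1 v q G := le_self_add
  · rw [not_le] at hr4
    have hsub : parabolicCylinder r z0 ⊆ parabolicCylinder 1 z0 := parabolicCylinder_mono hr.1.le hr.2 z0
    have hfac1 : ENNReal.ofReal (1 / r) ≤ 16 := by
      rw [← ENNReal.ofReal_ofNat 16]
      refine ENNReal.ofReal_le_ofReal ?_
      rw [div_le_iff₀ hr.1]; linarith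
    have hfac2 : ENNReal.ofReal (1 / r) ^ 2 ≤ 16 := by
      rw [← ENNReal.ofReal_pow (by positivity), ← ENNReal.ofReal_ofNat 16]
      refine ENNReal.ofReal_le_ofReal ?_
      have h4 : 1 / r ≤ 4 := by rw [div_le_iff₀ hr.1]; linarith
      have h0 : 0 ≤ 1 / r := by positivity
      nlinarith
    have hEr : cknE r z0 G ≤ 16 * cknE 1 z0 G :=
      (cknE_le_mul_of_subset one_pos hr.1 hsub G).trans (mul_le_mul' hfac1 le_rfl)
    have hAr : cknAEss r z0 v ≤ 16 * cknAEss 1 z0 v := by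
      refine (cknAEss_le_mul_of_subset one_pos hr.1 (Ioo_subset_Ioo ?_ le_rfl)
        (ball_subset_ball hr.2) v).trans (mul_le_mul' hfac1 le_rfl)
      have : r ^ 2 ≤ 1 ^ 2 := pow_le_pow_left₀ hr.1.le hr.2 2
      linarith
    have hDr : cknD r z0 q ≤ 16 * cknD 1 z0 q :=
      (cknD_le_mul_of_subset one_pos hr.1 hsub q).trans (mul_le_mul' hfac2 le_rfl)
    calc energySumEss r v q G = cknE r z0 G + cknAEss r z0 v + cknD r z0 q := by
          unfold energySumEss; rw [hz0]
      _ ≤ 16 * cknE 1 z0 G + 16 * cknAEss 1 z0 v + 16 * cknD 1 z0 q :=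
          add_le_add (add_le_add hEr hAr) hDr
      _ = 16 * energySumEss 1 v q G := by unfold energySumEss; rw [hz0]; ring
      _ ≤ (K : ℝ≥0∞) + 16 * energySumEss 1 v q G := le_add_self

/-! ## §7. The discharge -/

/-- An elementary lower bound: for `K ≥ 0`, `m > 0` and `0 < ε`,
`K + 1 ≤ ((K+1)²/m) ε + m/ε` (compare `ε` with `m/(K+1)`). [folklore] -/
private theorem succ_le_mul_add_div {K m ε : ℝ} (hK : 0 ≤ K) (hm : 0 < m) (hε : 0 < ε) :
    K + 1 ≤ (K + 1) ^ 2 / m * ε + m / ε := by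
  have hK1 : 0 < K + 1 := by linarith
  rcases le_or_gt (m / (K + 1)) ε with h | h
  · have h1 : (K + 1) ^ 2 / m * (m / (K + 1)) ≤ (K + 1) ^ 2 / m * ε :=
      mul_le_mul_of_nonneg_left h (by positivity)
    have e : (K + 1) ^ 2 / m * (m / (K + 1)) = K + 1 := by field_simp
    have h2 : 0 < m / ε := by positivity
    linarith
  · have h1 : K + 1 < m / ε := by
      rw [lt_div_iff₀ hε]
      have h' : ε * (K + 1) < m := (lt_div_iff₀ hK1).1 h
      linarith
    have h2 : 0 ≤ (K + 1) ^ 2 / m * ε := by positivity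
    linarith

/-- **Discharge of `seregin2023_morreyBound_scaledEnergies`** ([Seregin2023] Thm 1.1, p. 3, as
typed in `MorreyTypeIBound.lean`). With `c₀(ε, M) = M/ε` for `M > 0` (and `c₀(ε, 0) = 1/ε`;
`c₀(ε, ·) → 0` as `M → 0⁺`): given a solution with `M < ∞`, either `𝓔(1) = ∞` and (1.6) is
trivial, or `𝓔 ≤ K < ∞` on `]0, 1]` by `exists_energySumEss_le`, and then (1.6) holds with
`α₀ = 1/2`, `ε₀ = 1` and `c = (K+1)²(1 + 1/M)`, because `c ε + c₀(ε, M) ≥ K + 1` for every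
`0 < ε ≤ 1`. [cite: Seregin2023, Thm 1.1 (p. 3), Appendix III (pp. 25–26)] -/
theorem seregin2023_morreyBound_scaledEnergies_holds : seregin2023_morreyBound_scaledEnergies := by
  intro s l hs hl hκ
  refine ⟨fun ε M => if M = 0 then ε⁻¹ else M / ε, fun ε _ => ?_, fun v q G hv hG hM => ?_⟩
  · -- `c₀(ε, ·) → 0` as `M → 0⁺`
    have h1 : Tendsto (fun M : ℝ => M / ε) (𝓝[>] 0) (𝓝 0) := by
      have h : Tendsto (fun M : ℝ => M / ε) (𝓝 0) (𝓝 (0 / ε)) := tendsto_id.div_const ε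
      rw [zero_div] at h
      exact h.mono_left nhdsWithin_le_nhds
    refine h1.congr' ?_
    filter_upwards [self_mem_nhdsWithin] with M hM
    rw [if_neg (ne_of_gt hM)]
  · by_cases h1 : energySumEss 1 v q G = ∞
    · -- `𝓔(1) = ∞`: the right-hand side of (1.6) is infinite
      refine ⟨1, 1, 1 / 2, one_pos, one_pos, by norm_num, by norm_num, fun r hr ε hε => ?_⟩
      have hpos : 0 < 1 * r ^ (1 / 2 : ℝ) := by
        rw [one_mul]; exact Real.rpow_pos_of_pos hr.1 _
      have htop : ENNReal.ofReal (1 * r ^ (1 / 2 : ℝ)) * energySumEss 1 v q G = ∞ := by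
        rw [h1, ENNReal.mul_top (ENNReal.ofReal_pos.2 hpos).ne']
      rw [htop, top_add, top_add]
      exact le_top
    · obtain ⟨K, hKtop, hK⟩ := exists_energySumEss_le hs hl hκ hv hG hM (lt_top_iff_ne_top.2 h1)
      set Mr : ℝ := (morreySup s l v).toReal with hMr
      set Kr : ℝ := K.toReal with hKr
      have hKr0 : 0 ≤ Kr := ENNReal.toReal_nonneg
      have hMr0 : 0 ≤ Mr := ENNReal.toReal_nonneg
      have hKeq : K = ENNReal.ofReal Kr := (ENNReal.ofReal_toReal hKtop.ne).symm
      set c : ℝ := (Kr + 1) ^ 2 * (1 + Mr⁻¹) with hc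
      have hcpos : 0 < c := by rw [hc]; positivity
      refine ⟨1, c, 1 / 2, one_pos, hcpos, by norm_num, by norm_num, fun r hr ε hε => ?_⟩
      -- the key inequality `K + 1 ≤ c ε + c₀(ε, M)`
      have hc₀nonneg : 0 ≤ (if Mr = 0 then ε⁻¹ else Mr / ε) := by
        split_ifs
        · exact (inv_pos.2 hε.1).le
        · exact div_nonneg hMr0 hε.1.le
      have key : Kr + 1 ≤ c * ε + (if Mr = 0 then ε⁻¹ else Mr / ε) := by
        by_cases hM0 : Mr = 0
        · rw [if_pos hM0]
          have h := succ_le_mul_add_div hKr0 one_pos hε.1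
          have hc1 : (Kr + 1) ^ 2 / 1 * ε ≤ c * ε := by
            refine mul_le_mul_of_nonneg_right ?_ hε.1.le
            rw [div_one, hc]
            have : (0 : ℝ) ≤ Mr⁻¹ := inv_nonneg.2 hMr0
            nlinarith [sq_nonneg (Kr + 1)]
          rw [one_div] at h
          linarith
        · rw [if_neg hM0]
          have hMpos : 0 < Mr := lt_of_le_of_ne hMr0 (Ne.symm hM0)
          have h := succ_le_mul_add_div hKr0 hMpos hε.1
          have hc1 : (Kr + 1) ^ 2 / Mr * ε ≤ c * ε := by
            refine mul_le_mul_of_nonneg_right ?_ hε.1.le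
            rw [hc, div_eq_mul_inv]
            nlinarith [sq_nonneg (Kr + 1), inv_pos.2 hMpos]
          linarith
      -- conclusion
      calc energySumEss r v q G ≤ K := hK r hr
        _ = ENNReal.ofReal Kr := hKeq
        _ ≤ ENNReal.ofReal (c * ε + (if Mr = 0 then ε⁻¹ else Mr / ε)) :=
            ENNReal.ofReal_le_ofReal (by linarith)
        _ = ENNReal.ofReal (c * ε) + ENNReal.ofReal (if Mr = 0 then ε⁻¹ else Mr / ε) :=
            ENNReal.ofReal_add (mul_nonneg hcpos.le hε.1.le) hc₀nonneg
        _ ≤ ENNReal.ofReal (c * r ^ (1 / 2 : ℝ)) * energySumEss 1 v q G + ENNReal.ofReal (c * ε) +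
            ENNReal.ofReal (if Mr = 0 then ε⁻¹ else Mr / ε) := by
            rw [add_assoc]; exact le_add_self

/-! ## §8. The consumers of `MorreyTypeIBound.lean`, now unconditional -/

section Consequences

variable {s l : ℝ} {v : ℝ → EuclideanSpace ℝ (Fin 3) → EuclideanSpace ℝ (Fin 3)}
  {q : ℝ → EuclideanSpace ℝ (Fin 3) → ℝ}
  {G : ℝ → EuclideanSpace ℝ (Fin 3) → EuclideanSpace ℝ (Fin 3) →L[ℝ] EuclideanSpace ℝ (Fin 3)}

/-- **Theorem 1.1, qualitative form, unconditionally**: under (1.4)–(1.5) and `𝓔(1) < ∞`,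
`𝓔(r) < ∞` for every `0 < r ≤ 1`. [cite: Seregin2023, Thm 1.1 (p. 3)] -/
theorem morreyBounded_energySumEss_lt_top (hs : 1 ≤ s) (hl : 1 ≤ l) (hκ : kappa s l < l)
    (hv : IsSuitableWeakSolutionInBall 1 0 v q)
    (hG : HasWeakSpatialGradientOn
      (parabolicCylinderOpens 1 (0 : ℝ × EuclideanSpace ℝ (Fin 3))) v G)
    (hM : morreySup s l v < ∞) (h1 : energySumEss 1 v q G < ∞) {r : ℝ} (hr : r ∈ Ioc (0 : ℝ) 1) :
    energySumEss r v q G < ∞ :=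
  seregin2023_morreyBound_scaledEnergies.energySumEss_lt_top
    seregin2023_morreyBound_scaledEnergies_holds hs hl hκ hv hG hM h1 hr

/-- **A bounded generalised Morrey quantity excludes an energy-Type-II blow-up, unconditionally**:
under (1.4)–(1.5) and `𝓔(1) < ∞`, Seregin's 2020 blow-up index at the origin is finite,
`g(0) < ∞`. [cite: Seregin2023, Thm 1.1 and §1 p. 3; cf. Seregin2020, Def. 1.7] -/
theorem morreyBounded_blowupIndex_lt_top (hs : 1 ≤ s) (hl : 1 ≤ l) (hκ : kappa s l < l)
    (hv : IsSuitableWeakSolutionInBall 1 0 v q)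
    (hG : HasWeakSpatialGradientOn
      (parabolicCylinderOpens 1 (0 : ℝ × EuclideanSpace ℝ (Fin 3))) v G)
    (hM : morreySup s l v < ∞) (h1 : energySumEss 1 v q G < ∞) :
    Seregin2020.blowupIndex (0 : ℝ × EuclideanSpace ℝ (Fin 3)) v G < ∞ :=
  seregin2023_morreyBound_scaledEnergies.blowupIndex_lt_top
    seregin2023_morreyBound_scaledEnergies_holds hs hl hκ hv hG hM h1

/-- In the words of Seregin 2020, Def. 1.7, unconditionally: under (1.4)–(1.5) and `𝓔(1) < ∞`
the origin is NOT a Type II blow-up. [cite: Seregin2023, Thm 1.1 and §1 p. 3; cf. Seregin2020, Def. 1.7] -/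
theorem morreyBounded_not_isTypeIIAt (hs : 1 ≤ s) (hl : 1 ≤ l) (hκ : kappa s l < l)
    (hv : IsSuitableWeakSolutionInBall 1 0 v q)
    (hG : HasWeakSpatialGradientOn
      (parabolicCylinderOpens 1 (0 : ℝ × EuclideanSpace ℝ (Fin 3))) v G)
    (hM : morreySup s l v < ∞) (h1 : energySumEss 1 v q G < ∞) :
    ¬ Seregin2020.IsTypeIIAt (0 : ℝ × EuclideanSpace ℝ (Fin 3)) v G :=
  seregin2023_morreyBound_scaledEnergies.not_isTypeIIAt
    seregin2023_morreyBound_scaledEnergies_holds hs hl hκ hv hG hM h1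

end Consequences

/-! ## §9. The top-scale energies are finite; consequences without the hypothesis `𝓔(1) < ∞` -/

section TopScale

variable {s l : ℝ} {v : ℝ → EuclideanSpace ℝ (Fin 3) → EuclideanSpace ℝ (Fin 3)}
  {q : ℝ → EuclideanSpace ℝ (Fin 3) → ℝ}
  {G : ℝ → EuclideanSpace ℝ (Fin 3) → EuclideanSpace ℝ (Fin 3) →L[ℝ] EuclideanSpace ℝ (Fin 3)}

/-- **`𝓔(1) < ∞` is automatic**: for a suitable weak solution in `Q(1)` in the sense of
`IsSuitableWeakSolutionInBall` (global classes `v ∈ L^∞_t L²_x`, `∇v ∈ L²`, `q ∈ L^{3/2}` on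
`Q(1)`) and any weak spatial gradient `G` of `v` on `Q(1)`, `𝓔(1) = E(1) + A(1) + D(1) < ∞`
(`background_finite`: the a.e. uniqueness of weak gradients transfers the `L²` bound to `G`).
[cite: Seregin2023, §1 p. 2 (Def. of suitable weak solutions in `Q`, classes (1.1))] -/
theorem energySumEss_one_lt_top (hv : IsSuitableWeakSolutionInBall 1 0 v q)
    (hG : HasWeakSpatialGradientOn
      (parabolicCylinderOpens 1 (0 : ℝ × EuclideanSpace ℝ (Fin 3))) v G) :
    energySumEss 1 v q G < ∞ := by
  obtain ⟨hA, hE, -, hD, -⟩ := background_finite hv hG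
  unfold energySumEss
  exact ENNReal.add_lt_top.2 ⟨ENNReal.add_lt_top.2 ⟨hE.lt_top, hA.lt_top⟩, hD.lt_top⟩

/-- Theorem 1.1, qualitative form, with the automatic `𝓔(1) < ∞` removed: under (1.4)–(1.5),
`𝓔(r) < ∞` for every `0 < r ≤ 1`. [cite: Seregin2023, Thm 1.1 (p. 3)] -/
theorem energySumEss_lt_top_of_morreySup_lt_top (hs : 1 ≤ s) (hl : 1 ≤ l) (hκ : kappa s l < l)
    (hv : IsSuitableWeakSolutionInBall 1 0 v q)
    (hG : HasWeakSpatialGradientOn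
      (parabolicCylinderOpens 1 (0 : ℝ × EuclideanSpace ℝ (Fin 3))) v G)
    (hM : morreySup s l v < ∞) {r : ℝ} (hr : r ∈ Ioc (0 : ℝ) 1) :
    energySumEss r v q G < ∞ :=
  morreyBounded_energySumEss_lt_top hs hl hκ hv hG hM (energySumEss_one_lt_top hv hG) hr

/-- **Bounded `M^{s,l}_κ` ⇒ `g(0) < ∞`** (no Type II blow-up at the origin in the sense of
Seregin 2020, Def. 1.7), with the automatic hypothesis `𝓔(1) < ∞` removed.
[cite: Seregin2023, Thm 1.1 and §1 p. 3; cf. Seregin2020, Def. 1.7] -/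
theorem blowupIndex_lt_top_of_morreySup_lt_top (hs : 1 ≤ s) (hl : 1 ≤ l) (hκ : kappa s l < l)
    (hv : IsSuitableWeakSolutionInBall 1 0 v q)
    (hG : HasWeakSpatialGradientOn
      (parabolicCylinderOpens 1 (0 : ℝ × EuclideanSpace ℝ (Fin 3))) v G)
    (hM : morreySup s l v < ∞) :
    Seregin2020.blowupIndex (0 : ℝ × EuclideanSpace ℝ (Fin 3)) v G < ∞ :=
  morreyBounded_blowupIndex_lt_top hs hl hκ hv hG hM (energySumEss_one_lt_top hv hG)

/-- **Bounded `M^{s,l}_κ` ⇒ the origin is not a Type II blow-up** (Seregin 2020, Def. 1.7), with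
the automatic hypothesis `𝓔(1) < ∞` removed. [cite: Seregin2023, Thm 1.1 and §1 p. 3; cf. Seregin2020, Def. 1.7] -/
theorem not_isTypeIIAt_of_morreySup_lt_top (hs : 1 ≤ s) (hl : 1 ≤ l) (hκ : kappa s l < l)
    (hv : IsSuitableWeakSolutionInBall 1 0 v q)
    (hG : HasWeakSpatialGradientOn
      (parabolicCylinderOpens 1 (0 : ℝ × EuclideanSpace ℝ (Fin 3))) v G)
    (hM : morreySup s l v < ∞) :
    ¬ Seregin2020.IsTypeIIAt (0 : ℝ × EuclideanSpace ℝ (Fin 3)) v G :=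
  morreyBounded_not_isTypeIIAt hs hl hκ hv hG hM (energySumEss_one_lt_top hv hG)

/-- **Bounded `M^{s,l}_κ` at a singular point ⇒ Type I** ("a sufficient condition for the point
`z = 0` to be a Type I blowup", [Seregin2023] p. 3): under (1.4)–(1.5), if the origin is a
backward singular point then it is a Type I blow-up in the sense of Seregin 2020, Def. 1.7
(`Seregin2020.IsTypeIAt`: singular with `g(0) < ∞`). [cite: Seregin2023, Thm 1.1 and §1 p. 3; cf. Seregin2020, Def. 1.7] -/
theorem isTypeIAt_of_morreySup_lt_top (hs : 1 ≤ s) (hl : 1 ≤ l) (hκ : kappa s l < l)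
    (hv : IsSuitableWeakSolutionInBall 1 0 v q)
    (hG : HasWeakSpatialGradientOn
      (parabolicCylinderOpens 1 (0 : ℝ × EuclideanSpace ℝ (Fin 3))) v G)
    (hM : morreySup s l v < ∞)
    (hsing : IsBackwardSingularPoint v (0 : ℝ × EuclideanSpace ℝ (Fin 3))) :
    Seregin2020.IsTypeIAt (0 : ℝ × EuclideanSpace ℝ (Fin 3)) v G :=
  ⟨hsing, blowupIndex_lt_top_of_morreySup_lt_top hs hl hκ hv hG hM⟩

end TopScale

/-! ## §10. The bound with constants depending only on `(s, l, M, 𝓔(1))` -/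

/-- **Seregin 2023, Thm 1.1 — uniform form of the bound.** For `1 ≤ s`, `1 ≤ l`, `κ(s,l) < l`
and bounds `M_b`, `E_b` there is `K = K(s, l, M_b, E_b) < ∞` such that every suitable weak
solution in `Q(1)` with a weak spatial gradient `G`, `sup_{0<R<1} M^{s,l}_κ(v,R) ≤ M_b` and
`𝓔(1) ≤ E_b` satisfies `𝓔(r) ≤ K` for all `0 < r ≤ 1` — the solution-independent reading of the
constants in (1.6) ("there exist positive constants `ε₀, c, α₀` … `c₀(s,l,ε,M)`", p. 3), without
the decay in `r` and the behaviour as `M → 0`. Same proof as `exists_energySumEss_le`, with all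
constants fixed before the solution. [cite: Seregin2023, Thm 1.1 (p. 3), Appendix III (pp. 25–26)] -/
theorem exists_energySumEss_le_unif {s l : ℝ} (hs : 1 ≤ s) (hl : 1 ≤ l) (hκ : kappa s l < l)
    (Mb Eb : ℝ≥0) :
    ∃ K : ℝ≥0, ∀ (v : ℝ → EuclideanSpace ℝ (Fin 3) → EuclideanSpace ℝ (Fin 3))
      (q : ℝ → EuclideanSpace ℝ (Fin 3) → ℝ)
      (G : ℝ → EuclideanSpace ℝ (Fin 3) → EuclideanSpace ℝ (Fin 3) →L[ℝ] EuclideanSpace ℝ (Fin 3)),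
      IsSuitableWeakSolutionInBall 1 0 v q →
      HasWeakSpatialGradientOn
        (parabolicCylinderOpens 1 (0 : ℝ × EuclideanSpace ℝ (Fin 3))) v G →
      morreySup s l v ≤ Mb → energySumEss 1 v q G ≤ Eb →
      ∀ r ∈ Ioc (0 : ℝ) 1, energySumEss r v q G ≤ K := by
  set z0 : ℝ × EuclideanSpace ℝ (Fin 3) := 0 with hz0
  set Q1 : Opens (ℝ × EuclideanSpace ℝ (Fin 3)) := parabolicCylinderOpens 1 z0 with hQ1
  have hs0 : 0 < s := by linarith
  have hl0 : 0 < l := by linarith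
  -- ### the constants (all fixed before the solution)
  obtain ⟨a, K₀, h1a, ha3, hal, hcubic⟩ := exists_cubic_estimate hs hl hκ
  have h0a : 0 < a := by linarith
  obtain ⟨cp, hcp⟩ := seregin_sverak_pressure_decay_holds
  obtain ⟨δ₀, hδ₀, A₁, A₂, hiter⟩ := exists_bound_of_cubic_step_at_of_pressure_decay cp
  obtain ⟨c₁, c₂, c₃, hLEB⟩ := Seregin2020.localEnergyBound_top
  set β : ℝ := (3 - a) / 2 with hβ
  have hβ0 : 0 < β := by rw [hβ]; linarith
  have hβ1 : β < 1 := by rw [hβ]; linarith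
  set csum : ℝ≥0∞ := (c₁ : ℝ≥0∞) + c₂ + c₃ with hcsum
  have hcsumtop : csum ≠ ∞ := ENNReal.add_ne_top.2 ⟨ENNReal.add_ne_top.2
    ⟨ENNReal.coe_ne_top, ENNReal.coe_ne_top⟩, ENNReal.coe_ne_top⟩
  set K₁ : ℝ≥0∞ := (K₀ : ℝ≥0∞) * (Mb : ℝ≥0∞) ^ (a / l) * (9 * (1 + csum)) ^ β with hK₁
  have hK₁top : K₁ ≠ ∞ := by
    refine ENNReal.mul_ne_top (ENNReal.mul_ne_top ENNReal.coe_ne_top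
      (ENNReal.rpow_ne_top_of_nonneg (by positivity) ENNReal.coe_ne_top)) ?_
    exact ENNReal.rpow_ne_top_of_nonneg hβ0.le (ENNReal.mul_ne_top (by norm_num)
      (ENNReal.add_ne_top.2 ⟨ENNReal.one_ne_top, hcsumtop⟩))
  have hδ0' : (δ₀ : ℝ≥0∞) ≠ 0 := by exact_mod_cast hδ₀.ne'
  set Φ : ℝ≥0∞ := (δ₀ : ℝ≥0∞) + (K₁ * (δ₀ : ℝ≥0∞)⁻¹ ^ β) ^ (1 / (1 - β)) with hΦ
  have hΦtop : Φ ≠ ∞ := by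
    refine ENNReal.add_ne_top.2 ⟨ENNReal.coe_ne_top, ?_⟩
    refine ENNReal.rpow_ne_top_of_nonneg (div_nonneg zero_le_one (by linarith)) ?_
    exact ENNReal.mul_ne_top hK₁top
      (ENNReal.rpow_ne_top_of_nonneg hβ0.le (ENNReal.inv_ne_top.2 hδ0'))
  -- the uniform bound on `C(1/2) + D(1/2)` and on `C + D` below `1/2`
  set Top : ℝ≥0∞ := (K₀ : ℝ≥0∞) * (Mb : ℝ≥0∞) ^ (a / l) * (1 + 2 * (Eb : ℝ≥0∞) + 2 * Eb) ^ β +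
    4 * Eb with hTop
  have hToptop : Top ≠ ∞ := by
    refine ENNReal.add_ne_top.2 ⟨?_, ENNReal.mul_ne_top (by norm_num) ENNReal.coe_ne_top⟩
    refine ENNReal.mul_ne_top (ENNReal.mul_ne_top ENNReal.coe_ne_top
      (ENNReal.rpow_ne_top_of_nonneg (by positivity) ENNReal.coe_ne_top)) ?_
    exact ENNReal.rpow_ne_top_of_nonneg hβ0.le (ENNReal.add_ne_top.2 ⟨ENNReal.add_ne_top.2
      ⟨ENNReal.one_ne_top, ENNReal.mul_ne_top (by norm_num) ENNReal.coe_ne_top⟩,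
      ENNReal.mul_ne_top (by norm_num) ENNReal.coe_ne_top⟩)
  set Bnd : ℝ≥0∞ := (A₁ : ℝ≥0∞) * Top + A₂ * Φ with hBnd
  have hBndtop : Bnd ≠ ∞ := ENNReal.add_ne_top.2
    ⟨ENNReal.mul_ne_top ENNReal.coe_ne_top hToptop, ENNReal.mul_ne_top ENNReal.coe_ne_top hΦtop⟩
  obtain ⟨K, hK⟩ := Seregin2020.scaledEnergies_bounded_of_cknC_le_unif Bnd.toNNReal (4 * Eb)
  refine ⟨K + 48 * Eb, fun v q G hv hG hMb hEb r hr => ?_⟩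
  -- ### the solution
  have hsw : IsSuitableWeakSolutionOn Q1 1 0 v q := hv.1
  have hE1 : cknE 1 z0 G ≤ Eb := by
    refine le_trans ?_ hEb
    unfold energySumEss; exact le_add_right le_self_add
  have hA1 : cknAEss 1 z0 v ≤ Eb := by
    refine le_trans ?_ hEb
    unfold energySumEss; exact le_add_right le_add_self
  have hD1 : cknD 1 z0 q ≤ Eb := by
    refine le_trans ?_ hEb
    unfold energySumEss; exact le_add_self
  have hcyl : ∀ R : ℝ, 0 < R → R ≤ 1 →
      parabolicCylinder R z0 ⊆ (Q1 : Set (ℝ × EuclideanSpace ℝ (Fin 3))) := fun R hR hR1 => by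
    rw [hQ1, coe_parabolicCylinderOpens]; exact parabolicCylinder_mono hR.le hR1 z0
  have hAle : ∀ R ∈ Ioc (0 : ℝ) 1, cknAEss R z0 v ≤ ENNReal.ofReal (1 / R) * Eb := by
    intro R hR
    refine (cknAEss_le_mul_of_subset one_pos hR.1 (Ioo_subset_Ioo ?_ le_rfl)
      (ball_subset_ball hR.2) v).trans (mul_le_mul' le_rfl hA1)
    have : R ^ 2 ≤ 1 ^ 2 := pow_le_pow_left₀ hR.1.le hR.2 2
    linarith
  have hEle : ∀ R ∈ Ioc (0 : ℝ) 1, cknE R z0 G ≤ ENNReal.ofReal (1 / R) * Eb := fun R hR =>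
    (cknE_le_mul_of_subset one_pos hR.1 (parabolicCylinder_mono hR.1.le hR.2 z0) G).trans
      (mul_le_mul' le_rfl hE1)
  have hDle : ∀ R ∈ Ioc (0 : ℝ) 1, cknD R z0 q ≤ ENNReal.ofReal (1 / R) ^ 2 * Eb := fun R hR =>
    (cknD_le_mul_of_subset one_pos hR.1 (parabolicCylinder_mono hR.1.le hR.2 z0) q).trans
      (mul_le_mul' le_rfl hD1)
  have hAfin : ∀ R ∈ Ioc (0 : ℝ) 1, cknAEss R z0 v ≠ ∞ := fun R hR =>
    ne_top_of_le_ne_top (ENNReal.mul_ne_top ENNReal.ofReal_ne_top ENNReal.coe_ne_top) (hAle R hR)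
  have hEfin : ∀ R ∈ Ioc (0 : ℝ) 1, cknE R z0 G ≠ ∞ := fun R hR =>
    ne_top_of_le_ne_top (ENNReal.mul_ne_top ENNReal.ofReal_ne_top ENNReal.coe_ne_top) (hEle R hR)
  have hMsup : morreySup s l v ≤ Mb := hMb
  -- ### the cubic step
  have hstep : ∀ r : ℝ, 0 < r → 6 * r ≤ 1 / 2 →
      cknC r z0 v ≤ δ₀ * (cknC (6 * r) z0 v + cknD (6 * r) z0 q) + Φ := by
    intro r hr h6r
    have hr1 : r ≤ 1 := by linarith
    have hrlt1 : r < 1 := by linarith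
    have h2r : 2 * r ≤ 1 := by linarith
    set X : ℝ≥0∞ := cknC (6 * r) z0 v with hX
    set Y : ℝ≥0∞ := cknD (6 * r) z0 q with hY
    set S : ℝ≥0∞ := 1 + X + Y with hS
    have hc := hcubic v G hG r ⟨hr, hr1⟩ (hAfin r ⟨hr, hr1⟩) (hEfin r ⟨hr, hr1⟩)
    have hMr : morreyM (kappa s l) s l z0 v r ≤ Mb :=
      (morreyM_le_morreySup ⟨hr, hrlt1⟩).trans hMsup
    have hle := hLEB Q1 v q G hsw hG z0 (2 * r) (by positivity) (hcyl _ (by positivity) h2r)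
    rw [show 2 * r / 2 = r by ring] at hle
    have h6 : (0 : ℝ) < 6 * r := by positivity
    have h2 : (0 : ℝ) < 2 * r := by positivity
    have hsub : parabolicCylinder (2 * r) z0 ⊆ parabolicCylinder (6 * r) z0 :=
      parabolicCylinder_mono h2.le (by linarith) z0
    have hratio : ENNReal.ofReal (6 * r / (2 * r)) ^ 2 = 9 := by
      rw [show 6 * r / (2 * r) = 3 by field_simp; ring, ENNReal.ofReal_ofNat]; norm_num
    have hC2 : cknC (2 * r) z0 v ≤ 9 * X := by
      have h := Seregin2020.cknC_le_mul_of_subset h6 h2 hsub v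
      rwa [hratio] at h
    have hD2 : cknD (2 * r) z0 q ≤ 9 * Y := by
      have h := cknD_le_mul_of_subset h6 h2 hsub q
      rwa [hratio] at h
    have hT : 1 + cknC (2 * r) z0 v + cknD (2 * r) z0 q ≤ 9 * S := by
      calc 1 + cknC (2 * r) z0 v + cknD (2 * r) z0 q ≤ 9 * 1 + 9 * X + 9 * Y := by
            gcongr
            rw [mul_one]; norm_num
        _ = 9 * S := by rw [hS]; ring
    have hAE : 1 + cknAEss r z0 v + cknE r z0 G ≤ 9 * (1 + csum) * S := by
      have hT1 := rpow_le_one_add (by norm_num : (0 : ℝ) ≤ 2 / 3) (by norm_num : (2 / 3 : ℝ) ≤ 1)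
        (cknC (2 * r) z0 v)
      have hT2 := rpow_two_thirds_mul_rpow_one_third_le_one_add (cknC (2 * r) z0 v) (cknD (2 * r) z0 q)
      have hT3 : cknC (2 * r) z0 v ≤ 1 + cknC (2 * r) z0 v + cknD (2 * r) z0 q :=
        le_add_right le_add_self
      have hT1' : cknC (2 * r) z0 v ^ (2 / 3 : ℝ) ≤ 1 + cknC (2 * r) z0 v + cknD (2 * r) z0 q :=
        hT1.trans le_self_add
      calc 1 + cknAEss r z0 v + cknE r z0 G = 1 + (cknAEss r z0 v + cknE r z0 G) := add_assoc _ _ _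
        _ ≤ 1 + ((c₁ : ℝ≥0∞) * cknC (2 * r) z0 v ^ (2 / 3 : ℝ) + c₂ * cknC (2 * r) z0 v +
            c₃ * (cknD (2 * r) z0 q ^ (2 / 3 : ℝ) * cknC (2 * r) z0 v ^ (1 / 3 : ℝ))) := by
            gcongr
        _ ≤ 1 * (9 * S) + ((c₁ : ℝ≥0∞) * (9 * S) + c₂ * (9 * S) + c₃ * (9 * S)) := by
            refine add_le_add ?_ (add_le_add (add_le_add (mul_le_mul' le_rfl (hT1'.trans hT))
              (mul_le_mul' le_rfl (hT3.trans hT))) (mul_le_mul' le_rfl (hT2.trans hT)))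
            rw [one_mul]
            calc (1 : ℝ≥0∞) ≤ 9 * 1 := by norm_num
              _ ≤ 9 * S := by gcongr; rw [hS, add_assoc]; exact le_self_add
        _ = 9 * (1 + csum) * S := by rw [hcsum]; ring
    have hCr : cknC r z0 v ≤ K₁ * S ^ β := by
      calc cknC r z0 v ≤ (K₀ : ℝ≥0∞) * morreyM (kappa s l) s l z0 v r ^ (a / l) *
            (1 + cknAEss r z0 v + cknE r z0 G) ^ ((3 - a) / 2) := hc
        _ ≤ (K₀ : ℝ≥0∞) * (Mb : ℝ≥0∞) ^ (a / l) * (9 * (1 + csum) * S) ^ ((3 - a) / 2) := by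
            gcongr
        _ = K₁ * S ^ β := by
            rw [hK₁, hβ, ENNReal.mul_rpow_of_nonneg _ S (by linarith : (0 : ℝ) ≤ (3 - a) / 2)]
            ring
    have hYoung := Seregin2020.rpow_le_mul_add hβ0 hβ1 K₁ S hδ0' ENNReal.coe_ne_top
    calc cknC r z0 v ≤ K₁ * S ^ β := hCr
      _ ≤ (δ₀ : ℝ≥0∞) * S + (K₁ * (δ₀ : ℝ≥0∞)⁻¹ ^ β) ^ (1 / (1 - β)) := hYoung
      _ = δ₀ * (X + Y) + Φ := by rw [hS, hΦ]; ring
  -- ### monotonicity and pressure decay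
  have hmonoC : ∀ r' R : ℝ, 0 < r' → r' ≤ R → R ≤ 1 / 2 →
      cknC r' z0 v ≤ ENNReal.ofReal (R / r') ^ 2 * cknC R z0 v := fun r' R hr' hrR _ =>
    Seregin2020.cknC_le_mul_of_subset (hr'.trans_le hrR) hr' (parabolicCylinder_mono hr'.le hrR z0) v
  have hmonoD : ∀ r' R : ℝ, 0 < r' → r' ≤ R → R ≤ 1 / 2 →
      cknD r' z0 q ≤ ENNReal.ofReal (R / r') ^ 2 * cknD R z0 q := fun r' R hr' hrR _ =>
    cknD_le_mul_of_subset (hr'.trans_le hrR) hr' (parabolicCylinder_mono hr'.le hrR z0) q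
  have hPD : ∀ ϱ ρ : ℝ, 0 < ϱ → ϱ ≤ ρ → ρ ≤ 1 / 2 →
      cknD ϱ z0 q ≤ cp * (ENNReal.ofReal (ϱ / ρ) * cknD ρ z0 q +
        ENNReal.ofReal ((ρ / ϱ) ^ 2) * cknC ρ z0 v) := fun ϱ ρ hϱ hϱρ hρ =>
    hcp Q1 v q hsw.distributional z0 ρ ϱ hϱ hϱρ (hcyl ρ (hϱ.trans_le hϱρ) (by linarith))
  -- ### the iteration
  have hhalf : (1 / 2 : ℝ) ∈ Ioc (0 : ℝ) 1 := ⟨by norm_num, by norm_num⟩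
  have hbound := hiter (fun ρ => cknC ρ z0 v) (fun ρ => cknD ρ z0 q) (1 / 2) Φ (by norm_num)
    hmonoC hmonoD hstep hPD
  -- the top-scale quantities against the uniform bound `Top`
  have h2fac : ENNReal.ofReal (1 / (1 / 2 : ℝ)) = 2 := by norm_num
  have hChalf : cknC (1 / 2) z0 v ≤ (K₀ : ℝ≥0∞) * (Mb : ℝ≥0∞) ^ (a / l) *
      (1 + 2 * (Eb : ℝ≥0∞) + 2 * Eb) ^ β := by
    have hc := hcubic v G hG (1 / 2) hhalf (hAfin _ hhalf) (hEfin _ hhalf)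
    refine hc.trans ?_
    have hM2 : morreyM (kappa s l) s l z0 v (1 / 2) ≤ Mb :=
      (morreyM_le_morreySup ⟨by norm_num, by norm_num⟩).trans hMsup
    have hA2 : cknAEss (1 / 2) z0 v ≤ 2 * Eb := by
      have h := hAle _ hhalf; rwa [h2fac] at h
    have hE2 : cknE (1 / 2) z0 G ≤ 2 * Eb := by
      have h := hEle _ hhalf; rwa [h2fac] at h
    rw [hβ]
    gcongr
  have hDhalf : cknD (1 / 2) z0 q ≤ 4 * Eb := by
    have h := hDle _ hhalf
    rw [h2fac] at h
    refine h.trans_eq ?_; norm_num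
  have hTop' : cknC (1 / 2) z0 v + cknD (1 / 2) z0 q ≤ Top := add_le_add hChalf hDhalf
  -- ### Seregin's lemma on `]0, 1/4]`
  have hK' := hK Q1 v q G hsw hG z0 (1 / 2) (by norm_num) (hcyl _ (by norm_num) (by norm_num))
    (by push_cast; exact hDhalf)
    (fun r hr => by
      rw [ENNReal.coe_toNNReal hBndtop]
      refine le_self_add.trans ((hbound r hr).trans ?_)
      rw [hBnd]
      gcongr)
  -- ### conclusion
  by_cases hr4 : r ≤ 1 / 4
  · have h := hK' r ⟨hr.1, by linarith⟩
    push_cast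
    calc energySumEss r v q G = (cknAEss r z0 v + cknE r z0 G) + cknD r z0 q := by
          unfold energySumEss; rw [hz0]; ring
      _ ≤ (cknAEss r z0 v + cknE r z0 G + cknC r z0 v) + cknD r z0 q :=
          add_le_add le_self_add le_rfl
      _ ≤ K := h
      _ ≤ (K : ℝ≥0∞) + 48 * Eb := le_self_add
  · rw [not_le] at hr4
    have hfac1 : ENNReal.ofReal (1 / r) ≤ 16 := by
      rw [← ENNReal.ofReal_ofNat 16]
      refine ENNReal.ofReal_le_ofReal ?_
      rw [div_le_iff₀ hr.1]; linarith
    have hfac2 : ENNReal.ofReal (1 / r) ^ 2 ≤ 16 := by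
      rw [← ENNReal.ofReal_pow (by positivity), ← ENNReal.ofReal_ofNat 16]
      refine ENNReal.ofReal_le_ofReal ?_
      have h4 : 1 / r ≤ 4 := by rw [div_le_iff₀ hr.1]; linarith
      have h0 : 0 ≤ 1 / r := by positivity
      nlinarith
    have hEr : cknE r z0 G ≤ 16 * Eb := (hEle r hr).trans (mul_le_mul' hfac1 le_rfl)
    have hAr : cknAEss r z0 v ≤ 16 * Eb := (hAle r hr).trans (mul_le_mul' hfac1 le_rfl)
    have hDr : cknD r z0 q ≤ 16 * Eb := (hDle r hr).trans (mul_le_mul' hfac2 le_rfl)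
    push_cast
    calc energySumEss r v q G = cknE r z0 G + cknAEss r z0 v + cknD r z0 q := by
          unfold energySumEss; rw [hz0]
      _ ≤ 16 * (Eb : ℝ≥0∞) + 16 * Eb + 16 * Eb := add_le_add (add_le_add hEr hAr) hDr
      _ = 48 * (Eb : ℝ≥0∞) := by ring
      _ ≤ (K : ℝ≥0∞) + 48 * Eb := le_add_self

end Literature.Analysis.FluidPDE.Seregin2023

end
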